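import Literature.AlgebraicGeometry.Motives.GeneralisedDecompositionOfTheDiagonal
import Literature.AlgebraicGeometry.Motives.CyclesPushforwardProofs
import Literature.AlgebraicGeometry.Motives.CyclesPushforwardNormProofs
import Literature.AlgebraicGeometry.Motives.SubschemeCyclesPushPullProofs
import Literature.AlgebraicGeometry.Motives.CyclesBirationalLiftProofs
import Literature.AlgebraicGeometry.Motives.OpenImmersionGraph
import Literature.AlgebraicGeometry.Motives.VarietiesProperProofs
import Literature.AlgebraicGeometry.Motives.VeryGeneralPoint
import Literature.AlgebraicGeometry.Motives.GeometricallyIntegralAlgClosed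
import Literature.AlgebraicGeometry.Motives.SubschemeCyclesRatComponentsProofs
import Literature.AlgebraicGeometry.Motives.GenericFibreCycles
import Literature.AlgebraicGeometry.Motives.BlochSrinivasPrincipleFiniteCoverLimitProofs
import Literature.AlgebraicGeometry.Motives.BlochSrinivasPrincipleFiniteCoverStepsProofs
import Literature.AlgebraicGeometry.Motives.BlochSrinivasPrincipleProofs
import Literature.AlgebraicGeometry.Motives.FiniteFlatDegreeProofs
import Literature.AlgebraicGeometry.Motives.GenericFibreSubschemeCycle
import Literature.AlgebraicGeometry.Motives.ChowLocalization
import Literature.AlgebraicGeometry.Motives.SubschemeCyclesProofs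
import Literature.AlgebraicGeometry.Motives.CyclesBaseChangeProofs
import Mathlib.FieldTheory.IsAlgClosed.AlgebraicClosure
import Literature.AlgebraicGeometry.Motives.ChowLocalizationProofs
import Literature.AlgebraicGeometry.Motives.CyclesDimensionProofs
import Literature.AlgebraicGeometry.Motives.VarietiesQuasiCompactProofs
import Literature.AlgebraicGeometry.Motives.VarietiesGeometricallyIntegralProofs
import HarnessLib

/-!
# The generalised decomposition of the diagonal (Voisin II, Thm. 10.29): proof of `ParanjapeLaterveer_generalisedDecompositionOfTheDiagonal`

Companion ("Proofs") file of `Literature/AlgebraicGeometry/Motives/GeneralisedDecompositionOfTheDiagonal`,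
whose named fact `ParanjapeLaterveer_generalisedDecompositionOfTheDiagonal` (C. Voisin, *Hodge Theory
and Complex Algebraic Geometry II*, CUP 2003, Thm. 10.29, with the hypothesis in rank-one form
`ChowRankLEOneUpTo X k₀`: "`dim_ℚ CH_j(X) ⊗ ℚ ≤ 1` for `j ≤ k₀`") is DISCHARGED here
(`ParanjapeLaterveer_generalisedDecompositionOfTheDiagonal_holds`, last section) along the
tree's Hilbert-scheme-free route to the case `k₀ = 0`
(`Literature.Barriers.HodgeConjecture.BlochSrinivas1983_decompositionOfTheDiagonal_holds`: very
general point, descent to a finite extension, spreading out over a finite flat cover, trace,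
localisation sequence), run over the components of `T` in the induction of the printed proof
(pp. 264–265). This first part supplies the arithmetic input by which the RATIONAL hypothesis
(rank `≤ 1` of `CH₀(X) ⊗ ℚ`) replaces the INTEGRAL one of Cor. 10.21 (`CH₀` supported on a closed
subset): on a proper variety a rational point is never torsion in `CH₀`, because proper
push-forward to the point (Fulton, *Intersection Theory*, Thm. 1.4, the tree's
`map_mem_ratTrivial_of_facts`) sends `Rat₀(X)` to `Rat₀(Spec K) = 0` and `[t]` to
`[κ(t):K]·[pt]` with `[κ(t):K] ≠ 0` (Zariski's lemma); hence under `ChowRankLEOneUpTo X k₀` every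
`0`-cycle `c` satisfies `a • c ∼ b • [t]` with `a ≠ 0`
(`ChowRankLEOneUpTo.exists_smul_rat_smul_pt`), the form in which the hypothesis enters the very
general point (Voisin II, remark after Cor. 10.28: "the condition `CH₀(X) = ℤ` is equivalent to the
fact that the map cl is injective on `CH₀(X)`" — here without the cycle class, by the degree).

The second part (sections `MagicIso` … `RankOneTransport`) is the transcendental step of the
induction of Thm. 10.29 for `k`-CYCLES, replacing the printed "kernel of `cl` is torsion +
countability/Baire" (p. 264) and, for `k = 0`, the tree's very general point
(`Motives/VeryGeneralPoint`): for `X` projective over an uncountable algebraically closed `C` of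
characteristic `0` with a countable model `X₀/k₀` and `j : C → Ω` into an algebraically closed
field of the same cardinality, Vial's isomorphism `Ψ : X ×_{C,j} Spec Ω ≅ X` over `X₀`
(`exists_iso_pullback_specMap_comp_eq`, from a `k₀`-linear `C ≃ Ω`,
`exists_ringEquiv_apply_algebraMap_eq`); the torsion-ness of the kernel of
`CH_k(X) → CH_k(X_Ω)` (`zsmul_mem_ratTrivial_of_baseChange`, Bloch's Lemma 1A.3 in this setting, by
a permutation argument on the prime cycles of a descended support); and the transport of the
rank-one hypothesis to `k`-cycles on `X_Ω` (`exists_zsmul_sub_baseChange_mem_ratTrivial`: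
`M • ζ ∼ w_Ω` with `M ≠ 0` and `w` a `k`-cycle on `X`).

The third part (sections `StepTwoSum` … `PrincipleForCycle`) is the Bloch–Srinivas principle of the
case `k₀ = 0` re-run for INTEGRAL COMBINATIONS of families of closed subschemes over an INTEGRAL
base of finite type (the components `T_j` of `T` in the induction of Thm. 10.29 are not smooth;
the printed proof desingularises them, the generic-point route does not need to): Bloch's limit
argument (`genericFibreRatTrivial_finiteExt_of_algExt_sum`), spreading out over the normalisation
and a finite flat cover (`genericFibreRatTrivial_spread_sum`), the trace argument
(`principle_sum_of_algExt`); the generic fibre over `Ω` of a `(d+e)`-cycle is a `d`-cycle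
(`familyFibreSum_mem_cyclesOfDim`, through the residue field of the generic point); the rank-one
hypothesis on that generic fibre (`exists_zsmul_familyFibreSum_sub_mem_ratTrivial`); and the
conclusion of this stage, Voisin's Thm. 10.19 in the form needed by the induction: for a
`(k+e)`-cycle `c` on `X × T`, some `N • c` is rationally trivial on `(X ∖ S) × U` for a closed `S`
of dimension `≤ k` and a dense open `U ⊆ T` (`exists_open_nsmul_restrict_mem_ratTrivial`).

The last part (sections `SplitCycle` … `Complex`) is the printed induction itself: at one component
`T = closure {t}` of codimension `k` (`inductionStep_component`: restriction to `X × T`, the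
principle, the localisation sequence on `X × T`, Fulton Prop. 1.8, proper push-forward along
`X × T ↪ X × X`, Fulton Thm. 1.4, and the splitting of the remainder by support), at all such
components (`inductionStep_level`, induction on their number), the induction on `k`
(`decomposition_sndForm`, the statement (10.17)), the exchange of the two factors of `X × X` and
the closed sets `T`, `W_i`, `W'_i` (`generalisedDecompositionOfTheDiagonal_of_uncountable`), and the
discharge over `ℂ` (`ParanjapeLaterveer_generalisedDecompositionOfTheDiagonal_holds`).

## References

* [VoisinHodgeII2003] C. Voisin, Hodge Theory and Complex Algebraic Geometry II, CUP 2003,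
  §10.3.1, Cor. 10.28 and the remark following it, Thm. 10.29 (proof pp. 264–265).
* [Fulton1998] W. Fulton, Intersection Theory, 2nd ed., Springer 1998, Def. 1.4, Thm. 1.4,
  Example 1.7.4, Example 6.2.9.
* [Vial2013] C. Vial, Algebraic cycles and fibrations, Doc. Math. 18 (2013) 1521–1553, Lemma 2.1.
* [BlochLectures2010] S. Bloch, Lectures on Algebraic Cycles, 2nd ed., CUP 2010, Lemma 1A.3.
* [GortzWedhorn2020] U. Görtz, T. Wedhorn, Algebraic Geometry I, 2nd ed. (2020), Prop. 5.51,
  Cor. 5.54, Prop. 10.75.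
* [Voisin2019BirationalDiagonal] C. Voisin, Birational invariants and decomposition of the
  diagonal, LN UMI 26 (2019), Thm. 2.1, Prop. 2.2, Thm. 2.3.
* [Hartshorne1977] R. Hartshorne, Algebraic Geometry, GTM 52 (1977), II Ex. 3.20.
* [Paranjape1994SmallChow] K. Paranjape, Cohomological and cycle-theoretic connectivity, Ann. of
  Math. 139 (1994) 641–660.
* [Laterveer1998] R. Laterveer, Algebraic varieties with small Chow groups, J. Math. Kyoto Univ. 38
  (1998) 673–694.
-/

noncomputable section

open CategoryTheory CategoryTheory.Limits AlgebraicGeometry Order MonoidalCategory Cardinal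

universe u

namespace Literature.AlgebraicGeometry.Motives

section Degree

variable {K : Type u} [Field K]

/-- **Closed points of a `K`-scheme locally of finite type have finite residue extension**: the
residue degree of `X → Spec K` at a point of height `0` is non-zero (Zariski's lemma, via
`residueDegree_ne_zero_of_height_asFiber_eq_zero`). [folklore] -/
theorem residueDegree_toSpecOver_ne_zero' (X : SchemeOver K) [LocallyOfFiniteType X.hom]
    {x : X.left} (hx : height x = 0) : (toSpecOver X).left.residueDegree x ≠ 0 := by
  haveI : Subsingleton ↥(specOver K K).left := inferInstanceAs (Subsingleton (PrimeSpectrum K))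
  haveI : LocallyOfFiniteType (toSpecOver X).left := inferInstanceAs (LocallyOfFiniteType X.hom)
  haveI : LocallyOfFiniteType (specOver K K).hom := by
    change LocallyOfFiniteType (Spec.map (CommRingCat.ofHom (algebraMap K K)))
    rw [HasRingHomProperty.Spec_iff (P := @LocallyOfFiniteType)]
    exact RingHom.FiniteType.id K
  refine residueDegree_ne_zero_of_height_asFiber_eq_zero (toSpecOver X).left x ?_
  have h := Scheme.height_eq_height_add_height_asFiber (toSpecOver X).left (specOver K K).hom x
  have h0 : height ((toSpecOver X).left x) = 0 := by
    rw [Order.height_eq_zero]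
    intro b _
    exact (Subsingleton.elim ((toSpecOver X).left x) b).le
  rw [hx, h0, zero_add] at h
  exact h.symm

/-- `Rat_d(Spec K) = 0`: the point has no closed subvarieties of dimension `d + 1`. [folklore] -/
theorem ratTrivial_specOver_self_eq_bot (d : ℕ) : ratTrivial (specOver K K).left d = ⊥ := by
  change AddSubgroup.closure (ratEquivGenerators (specOver K K).left d) = ⊥
  rw [AddSubgroup.closure_eq_bot_iff]
  rintro c ⟨-, W, _, f, -, hWdim, -⟩
  exfalso
  haveI : Subsingleton ↥(specOver K K).left := inferInstanceAs (Subsingleton (PrimeSpectrum K))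
  have h0 : W.dim = 0 := by
    change Order.height W.genericPoint = 0
    rw [Order.height_eq_zero]
    intro b _
    exact (Subsingleton.elim _ b).le
  rw [h0] at hWdim
  exact absurd hWdim.symm (by simp)

/-- Push-forward of cycles commutes with integer multiples. [folklore] -/
theorem algebraicCycleMap_zsmul {X' Y' : Scheme.{u}} (g : X' ⟶ Y') [QuasiCompact g] {N : Type*}
    [DecidableEq N] (wx : X' → N) (wy : Y' → N) (m : ℤ) (c : AlgebraicCycle X' ℤ) :
    AlgebraicCycle.map g wx wy (m • c) = m • AlgebraicCycle.map g wx wy c :=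
  map_zsmul (AddMonoidHom.mk' (AlgebraicCycle.map g wx wy) (algebraicCycleMap_add g wx wy)) m c

/-- **A rational point of a proper variety is not torsion in `CH₀`** (degree argument, Fulton
Def. 1.4 / Thm. 1.4): if `b • [t] ∈ Rat₀(X)` for a `K`-point `t` of a proper `K`-scheme `X`, then
`b = 0` — push forward along `X → Spec K` (Fulton Thm. 1.4, `map_mem_ratTrivial`), where
`Rat₀ = 0` and `[t] ↦ [κ(t):K]·[pt]` with `[κ(t):K] ≠ 0`. [cite: Fulton1998, Theorem 1.4 and Definition 1.4] -/
theorem eq_zero_of_zsmul_primeCycle_pt_mem_ratTrivial (X : SchemeOver K) [IsProper X.hom]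
    (t : AlgPoints X K) {b : ℤ} (hb : b • primeCycle t.pt ∈ ratTrivial X.left 0) : b = 0 := by
  classical
  have h14 : map_mem_ratTrivial 0 (k := K) :=
    map_mem_ratTrivial_of_facts map_div_eq_zero_of_dim_eq_add_one_holds map_div_eq_div_norm_holds 0
  haveI : IsProper (toSpecOver X).left := inferInstanceAs (IsProper X.hom)
  haveI : LocallyOfFiniteType (specOver K K).hom := by
    change LocallyOfFiniteType (Spec.map (CommRingCat.ofHom (algebraMap K K)))
    rw [HasRingHomProperty.Spec_iff (P := @LocallyOfFiniteType)]
    exact RingHom.FiniteType.id K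
  have h := h14 (toSpecOver X) hb
  rw [ratTrivial_specOver_self_eq_bot, AddSubgroup.mem_bot, algebraicCycleMap_zsmul,
    algebraicCycleMap_primeCycle_eq_nsmul,
    mapCoeff_height_eq_residueDegree (toSpecOver X).left (specOver K K).hom] at h
  have hdeg : (toSpecOver X).left.residueDegree t.pt ≠ 0 :=
    residueDegree_toSpecOver_ne_zero' X (OpenGraph.height_pt t)
  have happ := congrArg (fun c ↦ c ((toSpecOver X).left.base t.pt)) h
  simp only [Function.locallyFinsuppWithin.coe_zsmul, Function.locallyFinsuppWithin.coe_nsmul,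
    Pi.smul_apply, primeCycle_apply_self, Function.locallyFinsuppWithin.coe_zero,
    Pi.zero_apply] at happ
  simp only [nsmul_eq_mul, mul_one, smul_eq_mul, mul_eq_zero, Nat.cast_eq_zero] at happ
  exact happ.resolve_right hdeg

end Degree

section RankOne

/-- **Rank `≤ 1` on `0`-cycles forces a non-zero multiple of every `0`-cycle onto a point**: for a
proper `ℂ`… (any field `K`) scheme `X` with a `K`-point `t` and `ChowRankLEOneUpTo X k₀`, every
`0`-cycle `c` satisfies `a • c ∼ b • [t]` with `a ≠ 0` (the alternative `a = 0` would make `[t]`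
torsion, excluded by the degree). [cite: VoisinHodgeII2003, Cor. 10.28 (remark following it)]
[cite: Fulton1998, Theorem 1.4] -/
theorem ChowRankLEOneUpTo.exists_smul_rat_smul_pt {K : Type u} [Field K] {X : SchemeOver K}
    [IsProper X.hom] {k₀ : ℕ} (h : ChowRankLEOneUpTo X k₀) (t : AlgPoints X K)
    {c : AlgebraicCycle X.left ℤ} (hc : c ∈ cyclesOfDim X.left 0) :
    ∃ a b : ℤ, a ≠ 0 ∧ IsRationallyEquivalent (a • c) (b • primeCycle t.pt) 0 := by
  have hpt : primeCycle t.pt ∈ cyclesOfDim X.left 0 :=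
    primeCycle_mem_cyclesOfDim (OpenGraph.height_pt t)
  obtain ⟨a, b, hab, hrat⟩ := h 0 (Nat.zero_le _) c hc _ hpt
  refine ⟨a, b, ?_, hrat⟩
  rintro rfl
  have hb : b ≠ 0 := hab.resolve_left (fun h ↦ h rfl)
  apply hb
  refine eq_zero_of_zsmul_primeCycle_pt_mem_ratTrivial X t (b := b) ?_
  have h' := hrat.symm
  rw [IsRationallyEquivalent, zero_smul, sub_zero] at h'
  exact h'

end RankOne



section MagicIso

variable {C : Type} [Field C]

/-- **A `k₀`-linear isomorphism `C ≃ Ω` between two algebraically closed fields of the same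
uncountable cardinality** (`k₀ ⊆ C` countable, `j : C → Ω` any homomorphism): the classification
of algebraically closed fields (Mathlib `IsAlgClosed.ringEquiv_of_equiv_of_charZero`) gives some
`ψ : C ≃ Ω`, and the two embeddings `ψ ∘ (k₀ → C)`, `j ∘ (k₀ → C)` of the countable `k₀` into `Ω`
are conjugate under `Aut(Ω)` (`Literature.FieldTheory.AlgClosed.exists_ringEquiv_apply_eq`).
This is the isomorphism "from the field `Ω` to the field `\overline{Ω(B)}`" of Vial's Lemma 2.1,
normalised on a countable field of definition. [cite: Vial2013, Lemma 2.1 (proof)] -/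
theorem exists_ringEquiv_apply_algebraMap_eq [IsAlgClosed C] [CharZero C] (hC : ℵ₀ < #C)
    {k₀ : Type} [Field k₀] [Algebra k₀ C] (hk₀ : #k₀ ≤ ℵ₀)
    {Ω : Type} [Field Ω] [IsAlgClosed Ω] (j : C →+* Ω) (hΩ : #Ω = #C) :
    ∃ θ : C ≃+* Ω, ∀ x : k₀, θ (algebraMap k₀ C x) = j (algebraMap k₀ C x) := by
  letI : Algebra C Ω := j.toAlgebra
  haveI : CharZero Ω := charZero_of_injective_algebraMap j.injective
  obtain ⟨e⟩ : Nonempty (C ≃ Ω) := Cardinal.eq.1 hΩ.symm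
  obtain ⟨ψ⟩ := IsAlgClosed.ringEquiv_of_equiv_of_charZero hC ⟨e⟩
  have hΩbig : ℵ₀ < #Ω := by rw [hΩ]; exact hC
  obtain ⟨ρ, hρ⟩ := Literature.FieldTheory.AlgClosed.exists_ringEquiv_apply_eq hΩbig hk₀
    (ψ.toRingHom.comp (algebraMap k₀ C)) (j.comp (algebraMap k₀ C))
  exact ⟨ψ.trans ρ, fun x ↦ hρ x⟩

/-- **Vial's isomorphism `X_Ω ≅ X` (as abstract schemes, over a countable model).** Let `C` be
algebraically closed of characteristic `0` with `ℵ₀ < #C`, `X` a `C`-scheme which is the base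
change `X = X₀ ×_{k₀} Spec C` (cartesian square `H₀`) of a `k₀`-scheme `X₀` over a countable field
`k₀ ⊆ C`, and `j : C → Ω` a homomorphism to an algebraically closed field with `#Ω = #C`. Then
`X ×_{C,j} Spec Ω ≅ X` by an isomorphism commuting with the projections to `X₀`: both sides are
`X₀ ×_{k₀} Spec Ω` once `Ω` is identified with `C` by a `k₀`-linear isomorphism `θ`
(`exists_ringEquiv_apply_algebraMap_eq`), since `θ` and `j` agree on `k₀` ("this isomorphism turns
the scheme `X_b` over `Ω` into the scheme `F` over `\overline{Ω(B)}`", Vial 2013, Lemma 2.1; "the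
Chow groups of a variety `X` over a field only depend on `X` as a scheme").
[cite: Vial2013, Lemma 2.1 (proof)] -/
theorem exists_iso_pullback_specMap_comp_eq [IsAlgClosed C] [CharZero C] (hC : ℵ₀ < #C)
    (X : SchemeOver C) {k₀ : Type} [Field k₀] [Algebra k₀ C] (hk₀ : #k₀ ≤ ℵ₀)
    {X₀ : Scheme.{0}} (s₀ : X₀ ⟶ Spec (.of k₀)) (π₀ : X.left ⟶ X₀)
    (H₀ : IsPullback π₀ X.hom s₀ (Spec.map (CommRingCat.ofHom (algebraMap k₀ C))))
    {Ω : Type} [Field Ω] [IsAlgClosed Ω] (j : C →+* Ω) (hΩ : #Ω = #C) :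
    ∃ Ψ : ((baseChangeHom j).obj X).left ≅ X.left, Ψ.hom ≫ π₀ = baseChangeHomFst j X ≫ π₀ := by
  obtain ⟨θ, hθ⟩ := exists_ringEquiv_apply_algebraMap_eq hC hk₀ j hΩ
  have hθk₀ : θ.toRingHom.comp (algebraMap k₀ C) = j.comp (algebraMap k₀ C) := RingHom.ext hθ
  have SqΩ : IsPullback (pullback.fst X.hom (Spec.map (CommRingCat.ofHom j)) ≫ π₀)
      (pullback.snd X.hom (Spec.map (CommRingCat.ofHom j))) s₀
      (Spec.map (CommRingCat.ofHom (j.comp (algebraMap k₀ C)))) := by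
    have h := (IsPullback.of_hasPullback X.hom (Spec.map (CommRingCat.ofHom j))).paste_horiz H₀
    have e4 : Spec.map (CommRingCat.ofHom j) ≫ Spec.map (CommRingCat.ofHom (algebraMap k₀ C)) =
        Spec.map (CommRingCat.ofHom (j.comp (algebraMap k₀ C))) := by
      rw [← Spec.map_comp, ← CommRingCat.ofHom_comp]
    exact h.of_iso (Iso.refl _) (Iso.refl _) (Iso.refl _) (Iso.refl _) (by simp) (by simp)
      (by simp) (by simp only [Iso.refl_hom, Category.comp_id, Category.id_comp]; exact e4)
  have Sqθ : IsPullback (pullback.fst X.hom (Spec.map (CommRingCat.ofHom θ.toRingHom)) ≫ π₀)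
      (pullback.snd X.hom (Spec.map (CommRingCat.ofHom θ.toRingHom))) s₀
      (Spec.map (CommRingCat.ofHom (j.comp (algebraMap k₀ C)))) := by
    have h := (IsPullback.of_hasPullback X.hom
      (Spec.map (CommRingCat.ofHom θ.toRingHom))).paste_horiz H₀
    have e4 : Spec.map (CommRingCat.ofHom θ.toRingHom) ≫
        Spec.map (CommRingCat.ofHom (algebraMap k₀ C)) =
        Spec.map (CommRingCat.ofHom (j.comp (algebraMap k₀ C))) := by
      rw [← Spec.map_comp, ← CommRingCat.ofHom_comp, hθk₀]
    exact h.of_iso (Iso.refl _) (Iso.refl _) (Iso.refl _) (Iso.refl _) (by simp) (by simp)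
      (by simp) (by simp only [Iso.refl_hom, Category.comp_id, Category.id_comp]; exact e4)
  let Φ := SqΩ.isoIsPullback _ _ Sqθ
  have hΦ₁ : Φ.hom ≫ (pullback.fst X.hom (Spec.map (CommRingCat.ofHom θ.toRingHom)) ≫ π₀) =
      pullback.fst _ _ ≫ π₀ := SqΩ.isoIsPullback_hom_fst _ _ Sqθ
  haveI : IsIso (CommRingCat.ofHom θ.toRingHom) :=
    show IsIso θ.toCommRingCatIso.hom from inferInstance
  haveI : IsIso (Spec.map (CommRingCat.ofHom θ.toRingHom)) := inferInstance
  refine ⟨Φ ≪≫ asIso (pullback.fst X.hom (Spec.map (CommRingCat.ofHom θ.toRingHom))), ?_⟩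
  rw [Iso.trans_hom, asIso_hom, Category.assoc]
  exact hΦ₁

end MagicIso

/-! ### Transport of cycles along an isomorphism of schemes -/

section IsoTransport

variable {X Y : Scheme.{u}} (e : X ≅ Y)

/-- Push-forward along an isomorphism is transport of coefficients: `(e_* c)(e x) = c x`.
[folklore] -/
theorem algebraicCycleMap_hom_apply (c : AlgebraicCycle X ℤ) (x : X) :
    AlgebraicCycle.map e.hom height height c (e.hom.base x) = c x :=
  algebraicCycleMap_apply_base_of_isClosedImmersion e.hom c x

/-- Push-forward along an isomorphism, evaluated at a point of the target. [folklore] -/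
theorem algebraicCycleMap_hom_apply' (c : AlgebraicCycle X ℤ) (y : Y) :
    AlgebraicCycle.map e.hom height height c y = c (e.inv.base y) := by
  have hy : e.hom.base (e.inv.base y) = y := by
    rw [← Scheme.Hom.comp_apply, e.inv_hom_id]
    rfl
  conv_lhs => rw [← hy]
  exact algebraicCycleMap_hom_apply e c _

/-- `e⁻¹_* e_* c = c`. [folklore] -/
theorem algebraicCycleMap_inv_map_hom (c : AlgebraicCycle X ℤ) :
    AlgebraicCycle.map e.inv height height (AlgebraicCycle.map e.hom height height c) = c := by
  ext x
  have h := algebraicCycleMap_hom_apply' e.symm (AlgebraicCycle.map e.hom height height c) x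
  simp only [Iso.symm_hom, Iso.symm_inv] at h
  rw [h, algebraicCycleMap_hom_apply]

/-- `e_* e⁻¹_* c = c`. [folklore] -/
theorem algebraicCycleMap_hom_map_inv (c : AlgebraicCycle Y ℤ) :
    AlgebraicCycle.map e.hom height height (AlgebraicCycle.map e.inv height height c) = c :=
  algebraicCycleMap_inv_map_hom e.symm c

/-- An isomorphism preserves the dimension grading in both directions. [folklore] -/
theorem algebraicCycleMap_hom_mem_cyclesOfDim_iff {d : ℕ} (c : AlgebraicCycle X ℤ) :
    AlgebraicCycle.map e.hom height height c ∈ cyclesOfDim Y d ↔ c ∈ cyclesOfDim X d := by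
  refine ⟨fun h ↦ ?_, fun h ↦ map_mem_cyclesOfDim e.hom h⟩
  rw [← algebraicCycleMap_inv_map_hom e c]
  exact map_mem_cyclesOfDim e.inv h

variable {k : Type u} [Field k]

/-- **Rational equivalence only depends on the scheme**: push-forward along an isomorphism of
schemes (of finite type over a field) preserves `Rat_d` (Fulton, Thm. 1.4 for the proper morphism
`e`; "the Chow groups of a variety `X` over a field only depend on `X` as a scheme", Vial 2013,
proof of Lemma 2.1). [cite: Fulton1998, Theorem 1.4] [cite: Vial2013, Lemma 2.1 (proof)] -/
theorem algebraicCycleMap_hom_mem_ratTrivial (X' Y' : SchemeOver k) [LocallyOfFiniteType X'.hom]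
    [LocallyOfFiniteType Y'.hom] (e : X'.left ≅ Y'.left) (he : e.hom ≫ Y'.hom = X'.hom) {d : ℕ}
    {c : AlgebraicCycle X'.left ℤ} (hc : c ∈ ratTrivial X'.left d) :
    AlgebraicCycle.map e.hom height height c ∈ ratTrivial Y'.left d := by
  let f : X' ⟶ Y' := Over.homMk e.hom he
  haveI : IsProper f.left := inferInstanceAs (IsProper e.hom)
  exact map_mem_ratTrivial_of_facts map_div_eq_zero_of_dim_eq_add_one_holds
    map_div_eq_div_norm_holds d f hc

end IsoTransport

/-! ### Base change of a prime cycle to an algebraically closed field: one component, multiplicity one -/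

section PrimeCycleBaseChange

variable {C : Type u} [Field C] [IsAlgClosed C] (X : SchemeOver C) {Ω : Type u} [Field Ω]
  (j : C →+* Ω)

/-- For `V ⊆ X` a closed subvariety of a scheme locally of finite type over an ALGEBRAICALLY
CLOSED field `C` and any field homomorphism `j : C → Ω`, the base change
`V ×_X X_Ω = V ×_C Spec Ω` is integral (integral `C`-schemes are geometrically integral,
Görtz–Wedhorn I, Prop. 5.51). [cite: GortzWedhorn2020, Prop. 5.51 and Cor. 5.54] -/
theorem isIntegral_pullback_baseChangeHomFst (V : ClosedSubvariety X.left) :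
    IsIntegral (pullback V.ι (baseChangeHomFst j X)) := by
  have hsq : IsPullback (pullback.fst V.ι (baseChangeHomFst j X))
      (pullback.snd V.ι (baseChangeHomFst j X) ≫ ((baseChangeHom j).obj X).hom)
      (V.ι ≫ X.hom) (Spec.map (CommRingCat.ofHom j)) :=
    (IsPullback.of_hasPullback V.ι (baseChangeHomFst j X)).paste_vert
      (IsPullback.of_hasPullback X.hom (Spec.map (CommRingCat.ofHom j)))
  letI : Algebra C Ω := j.toAlgebra
  have hgi := (geometricallyIntegral_of_isAlgClosed (V.ι ≫ X.hom)).geometrically_isIntegral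
  exact hgi (Spec.map (CommRingCat.ofHom j)) _ _ hsq

/-- **`[V]_Ω = [V_Ω]` is a prime cycle**: for a point `p ∈ X` with closure `V = closure {p}`, the
base change `E [p] = π^*[V]` along `π : X_Ω → X` (`AlgebraicCycle.baseChange`, Fulton Ex. 6.2.9)
is the prime cycle of the generic point `q` of the integral scheme `V_Ω = V ×_X X_Ω`, and `q` lies
over `p`. [cite: Fulton1998, Example 6.2.9] -/
theorem baseChange_primeCycle_eq [LocallyOfFiniteType X.hom]
    (hπ : locallyFinsupp_flatPullbackFun_baseChangeHomFst.{u}) (p : X.left) :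
    haveI := isIntegral_pullback_baseChangeHomFst X j (ClosedSubvariety.ofPoint X.left p)
    AlgebraicCycle.baseChange j X hπ (primeCycle p) =
      primeCycle (pullback.snd (ClosedSubvariety.ofPoint X.left p).ι (baseChangeHomFst j X)
        (genericPoint ↥(pullback (ClosedSubvariety.ofPoint X.left p).ι (baseChangeHomFst j X) :
          Scheme.{u}))) ∧
    baseChangeHomFst j X (pullback.snd (ClosedSubvariety.ofPoint X.left p).ι (baseChangeHomFst j X)
        (genericPoint ↥(pullback (ClosedSubvariety.ofPoint X.left p).ι (baseChangeHomFst j X) :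
          Scheme.{u}))) = p := by
  haveI : IsLocallyNoetherian X.left := LocallyOfFiniteType.isLocallyNoetherian X.hom
  set V := ClosedSubvariety.ofPoint X.left p with hV
  haveI hint := isIntegral_pullback_baseChangeHomFst X j V
  haveI : IsLocallyNoetherian (pullback V.ι (baseChangeHomFst j X)) :=
    LocallyOfFiniteType.isLocallyNoetherian (pullback.snd V.ι (baseChangeHomFst j X))
  have hZ : locallyFinsupp_fundamentalCycleFun.{u} := locallyFinsupp_fundamentalCycleFun_holds
  constructor
  · have h1 : primeCycle p = V.toClosedSubscheme.cycle hZ := by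
      rw [ClosedSubvariety.cycle_toClosedSubscheme_holds V hZ, ClosedSubvariety.genericPoint_ofPoint]
    rw [h1, baseChange_cycle_eq_cycle_preimage j X hπ hZ V.toClosedSubscheme]
    change AlgebraicCycle.map (pullback.snd V.ι (baseChangeHomFst j X)) height height
      (fundamentalCycle (pullback V.ι (baseChangeHomFst j X)) hZ) = _
    rw [fundamentalCycle_of_isIntegral_holds (pullback V.ι (baseChangeHomFst j X)) hZ,
      algebraicCycleMap_primeCycle]
  · rw [← Scheme.Hom.comp_apply, ← pullback.condition, Scheme.Hom.comp_apply]
    have hmax : IsMax (genericPoint ↥(pullback V.ι (baseChangeHomFst j X) : Scheme.{u})) :=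
      (isMax_iff_eq_genericPoint).mpr rfl
    obtain ⟨-, hgen, -⟩ := isMax_pullback (baseChangeHomFst j X) V _ hmax
    rw [hgen]
    exact ClosedSubvariety.genericPoint_ofPoint (X := X.left) p

end PrimeCycleBaseChange

/-! ### Small order-theoretic and cycle helpers -/

section Helpers

variable {X : Scheme.{u}}

/-- Two comparable points with the same finite height are equal. [folklore] -/
theorem eq_of_le_of_height_eq {a b : X} (h : a ≤ b) (hb : height b ≠ ⊤) (heq : height a = height b) :
    a = b := by
  by_contra hne
  have hlt : a < b := lt_of_le_not_ge h fun hba ↦ hne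
    ((Scheme.le_iff_specializes.mp hba).antisymm (Scheme.le_iff_specializes.mp h)).eq
  have h1 := Order.height_add_one_le hlt
  rw [heq] at h1
  obtain ⟨n, hn⟩ := ENat.ne_top_iff_exists.mp hb
  rw [← hn] at h1
  exact absurd h1 (by norm_cast; omega)

/-- A finitely supported cycle is the sum of its prime cycles with its coefficients. [folklore] -/
theorem eq_sum_smul_primeCycle (c : AlgebraicCycle X ℤ) {S : Finset X}
    (hS : ∀ z, c z ≠ 0 → z ∈ S) : c = ∑ p ∈ S, c p • primeCycle p := by
  classical
  ext z
  simp only [Function.locallyFinsuppWithin.coe_sum, Function.locallyFinsuppWithin.coe_zsmul,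
    Finset.sum_apply, Pi.smul_apply, smul_eq_mul]
  by_cases hz : z ∈ S
  · rw [Finset.sum_eq_single_of_mem z hz (fun p _ hp ↦ by rw [primeCycle_apply_of_ne (Ne.symm hp), mul_zero]),
      primeCycle_apply_self, mul_one]
  · rw [Finset.sum_eq_zero (fun p hp ↦ ?_)]
    · by_contra h
      exact hz (hS z h)
    · rw [primeCycle_apply_of_ne (fun h : z = p ↦ hz (by rw [h]; exact hp)), mul_zero]

/-- Push-forward along an isomorphism sends prime cycles to prime cycles. [folklore] -/
theorem algebraicCycleMap_hom_primeCycle {Y : Scheme.{u}} (e : X ≅ Y) (x : X) :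
    AlgebraicCycle.map e.hom height height (primeCycle x) = primeCycle (e.hom.base x) := by
  classical
  ext y
  rw [algebraicCycleMap_hom_apply']
  by_cases hy : y = e.hom.base x
  · subst hy
    rw [primeCycle_apply_self, show e.inv.base (e.hom.base x) = x by
      rw [← Scheme.Hom.comp_apply, e.hom_inv_id]; rfl, primeCycle_apply_self]
  · rw [primeCycle_apply_of_ne hy, primeCycle_apply_of_ne]
    intro h
    apply hy
    rw [← h, ← Scheme.Hom.comp_apply, e.inv_hom_id]
    rfl

/-- Points of an isomorphism have the same height as their images. [folklore] -/
theorem height_iso_hom_base {Y : Scheme.{u}} (e : X ≅ Y) (x : X) : height (e.hom.base x) = height x :=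
  height_eq_of_homeomorph (Scheme.homeoOfIso e) x

end Helpers

/-! ### The kernel of `CH_k(X) → CH_k(X_Ω)` is torsion (very general point form) -/

section KernelTorsion

open Literature.AlgebraicGeometry.Limits

variable {C : Type} [Field C] [IsAlgClosed C] [CharZero C]

/-- **Injectivity of `CH_k(X) ⊗ ℚ → CH_k(X_Ω) ⊗ ℚ` for a projective variety over an uncountable
algebraically closed field, multiple by multiple** (Bloch, *Lectures on Algebraic Cycles*,
Lemma 1A.3: "the kernel of `CH(X_K) → CH(X_{K'})` is torsion"; here for `K = C` algebraically
closed, `K' = Ω` algebraically closed of the same cardinality, by Vial's isomorphism instead of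
specialisation): if `b • x_Ω ∈ Rat_k(X_Ω)` then `b • x ∈ Rat_k(X)`. Proof: descend `X` and the
closed set `⋃_{p ∈ supp x} closure {p}` to a countable `k₀ ⊆ C`
(`exists_isPullback_specMap_of_isProjectiveOver`) and let `Ψ : X_Ω ≅ X` be Vial's isomorphism over
the model (`exists_iso_pullback_specMap_comp_eq`); `D = Ψ_* ∘ (·)_Ω` preserves `Rat_k`, maps each
prime cycle `[p]`, `p ∈ supp x`, to a prime cycle `[p']` with `p' ∈ supp x` (`[p]_Ω` is the prime
cycle of the generic point of the integral `V_Ω`, which `Ψ` carries to a point of height `k` over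
`π₀(p)`, i.e. into `⋃ closure {p'}`), injectively; so `D` permutes these prime cycles, `D^N x = x`
for some `N ≥ 1`, and `b • D^m x ∈ Rat_k(X)` for all `m ≥ 1` by induction.
[cite: BlochLectures2010, Lemma 1A.3] [cite: Vial2013, Lemma 2.1 (proof)]
[cite: Fulton1998, Example 6.2.9] -/
theorem zsmul_mem_ratTrivial_of_baseChange (hC : ℵ₀ < #C) (X : SchemeOver C) [IsIntegral X.left]
    [LocallyOfFiniteType X.hom] [QuasiCompact X.hom] (hX : IsProjectiveOver X)
    {Ω : Type} [Field Ω] [IsAlgClosed Ω] (j : C →+* Ω) (hΩ : #Ω = #C)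
    (hπ : locallyFinsupp_flatPullbackFun_baseChangeHomFst.{0}) {k : ℕ}
    {x : AlgebraicCycle X.left ℤ} (hx : x ∈ cyclesOfDim X.left k) {b : ℤ}
    (hb : b • AlgebraicCycle.baseChange j X hπ x ∈ ratTrivial ((baseChangeHom j).obj X).left k) :
    b • x ∈ ratTrivial X.left k := by
  classical
  haveI : IsLocallyNoetherian X.left := LocallyOfFiniteType.isLocallyNoetherian X.hom
  haveI : CompactSpace ↥X.left := QuasiCompact.compactSpace_of_compactSpace X.hom
  -- the (finite) support of `x` and the closed set `Z = ⋃ closure {p}`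
  have hfin : (Function.support x).Finite := by
    simpa using x.locallyFiniteSupport.finite_inter_support_of_isCompact isCompact_univ
  set S : Finset X.left := hfin.toFinset with hSdef
  have hS : ∀ z, x z ≠ 0 → z ∈ S := fun z hz ↦ by simpa [hSdef] using hz
  have hS' : ∀ z ∈ S, x z ≠ 0 := fun z hz ↦ by simpa [hSdef] using hz
  set Z : Set X.left := ⋃ p ∈ S, closure {p} with hZdef
  have hZc : IsClosed Z := S.finite_toSet.isClosed_biUnion fun _ _ ↦ isClosed_closure
  -- descent of `X` and `Z` to a countable field `k₀`
  obtain ⟨t₀, N, X₀, hX₀, ι₀, hι₀, π₀, H₀, Z₀, hZ₀, hZeq⟩ :=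
    exists_isPullback_specMap_of_isProjectiveOver ℚ C X hX hZc
  have hk₀ : #(IntermediateField.adjoin ℚ (t₀ : Set C)) ≤ ℵ₀ :=
    cardinalMk_intermediateFieldAdjoin_le_aleph0 (by simp) t₀.finite_toSet
  -- notation: `Xb = X_Ω`, `E = (·)_Ω`
  let Xb : SchemeOver Ω := (baseChangeHom j).obj X
  let E : AlgebraicCycle X.left ℤ →+ AlgebraicCycle Xb.left ℤ := AlgebraicCycle.baseChange j X hπ
  -- Vial's isomorphism over the model
  obtain ⟨Ψ, hΨ⟩ := exists_iso_pullback_specMap_comp_eq hC X hk₀ _ π₀ H₀ j hΩ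
  let XbC : SchemeOver C := Over.mk (Ψ.hom ≫ X.hom)
  haveI : LocallyOfFiniteType XbC.hom := inferInstanceAs (LocallyOfFiniteType (Ψ.hom ≫ X.hom))
  let M : AlgebraicCycle Xb.left ℤ →+ AlgebraicCycle X.left ℤ :=
    AddMonoidHom.mk' (AlgebraicCycle.map Ψ.hom height height) (algebraicCycleMap_add Ψ.hom _ _)
  have hM : ∀ c, M c = AlgebraicCycle.map Ψ.hom height height c := fun _ ↦ rfl
  let D : AlgebraicCycle X.left ℤ →+ AlgebraicCycle X.left ℤ := M.comp E
  -- `D` and `E` on rational equivalence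
  have hMrat : ∀ c ∈ ratTrivial Xb.left k, M c ∈ ratTrivial X.left k := fun c hc ↦
    algebraicCycleMap_hom_mem_ratTrivial XbC X Ψ rfl hc
  have hErat : ∀ c ∈ ratTrivial X.left k, E c ∈ ratTrivial Xb.left k := fun c hc ↦
    Fulton1998_baseChange_mem_ratTrivial_holds j X hπ hc
  -- `D [p] = [p']` with `p' ∈ S`, for `p ∈ S`
  have hheight : ∀ p ∈ S, height p = k := fun p hp ↦ hx p (hS' p hp)
  have key : ∀ p ∈ S, ∃ p' ∈ S, D (primeCycle p) = primeCycle p' ∧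
      ∀ p₂ ∈ S, D (primeCycle p₂) = primeCycle p' → p₂ = p := by
    intro p hp
    haveI := isIntegral_pullback_baseChangeHomFst X j (ClosedSubvariety.ofPoint X.left p)
    obtain ⟨hEp, hq⟩ := baseChange_primeCycle_eq X j hπ p
    set q : Xb.left := pullback.snd (ClosedSubvariety.ofPoint X.left p).ι (baseChangeHomFst j X)
      (genericPoint ↥(pullback (ClosedSubvariety.ofPoint X.left p).ι (baseChangeHomFst j X) :
        Scheme.{0})) with hqdef
    have hDp : D (primeCycle p) = primeCycle (Ψ.hom.base q) := by
      change M (E (primeCycle p)) = _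
      rw [hEp, hM, algebraicCycleMap_hom_primeCycle]
    -- heights: `height q = height p = k`
    have hqk : height q = k := by
      have h1 : E (primeCycle p) ∈ cyclesOfDim Xb.left k :=
        AlgebraicCycle.baseChange_mem_cyclesOfDim_holds j X hπ
          (primeCycle_mem_cyclesOfDim (hheight p hp))
      rw [hEp] at h1
      exact h1 q (by rw [primeCycle_apply_self]; exact one_ne_zero)
    have hyk : height (Ψ.hom.base q) = k := by rw [height_iso_hom_base, hqk]
    -- `Ψ q` lies in `Z`
    have hyZ : Ψ.hom.base q ∈ Z := by
      have h1 : π₀.base (Ψ.hom.base q) = π₀.base p := by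
        rw [← Scheme.Hom.comp_apply, hΨ, Scheme.Hom.comp_apply]
        exact congrArg π₀.base hq
      have hpZ : p ∈ Z := Set.mem_biUnion (Finset.mem_coe.mpr hp) (subset_closure rfl)
      rw [hZeq, Set.mem_preimage] at hpZ ⊢
      rwa [h1]
    rw [hZdef] at hyZ
    obtain ⟨p', hp', hy'⟩ := Set.mem_iUnion₂.mp hyZ
    have hp'S : p' ∈ S := Finset.mem_coe.mp hp'
    have hle : Ψ.hom.base q ≤ p' :=
      Scheme.le_iff_specializes.mpr (specializes_iff_mem_closure.mpr hy')
    have heq : Ψ.hom.base q = p' :=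
      eq_of_le_of_height_eq hle (by rw [hheight p' hp'S]; exact ENat.coe_ne_top k)
        (by rw [hyk, hheight p' hp'S])
    refine ⟨p', hp'S, by rw [hDp, heq], fun p₂ hp₂ h2 ↦ ?_⟩
    -- injectivity
    haveI := isIntegral_pullback_baseChangeHomFst X j (ClosedSubvariety.ofPoint X.left p₂)
    obtain ⟨hEp₂, hq₂⟩ := baseChange_primeCycle_eq X j hπ p₂
    set q₂ : Xb.left := pullback.snd (ClosedSubvariety.ofPoint X.left p₂).ι (baseChangeHomFst j X)
      (genericPoint ↥(pullback (ClosedSubvariety.ofPoint X.left p₂).ι (baseChangeHomFst j X) :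
        Scheme.{0})) with hq₂def
    have hDp₂ : D (primeCycle p₂) = primeCycle (Ψ.hom.base q₂) := by
      change M (E (primeCycle p₂)) = _
      rw [hEp₂, hM, algebraicCycleMap_hom_primeCycle]
    rw [hDp₂, ← heq] at h2
    have h3 : Ψ.hom.base q₂ = Ψ.hom.base q := by
      have h4 := congrArg (fun c ↦ c (Ψ.hom.base q)) h2
      simp only [primeCycle_apply_self] at h4
      by_contra hne
      rw [primeCycle_apply_of_ne (Ne.symm hne)] at h4
      exact zero_ne_one h4
    have h5 : q₂ = q := (Scheme.homeoOfIso Ψ).injective h3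
    rw [← hq₂, ← hq]
    exact congrArg _ h5
  -- the permutation `τ` of `S`
  choose τ hτS hτD hτinj using key
  let τ' : S → S := fun p ↦ ⟨τ p.1 p.2, hτS p.1 p.2⟩
  have hτ'inj : Function.Injective τ' := by
    rintro ⟨p₁, hp₁⟩ ⟨p₂, hp₂⟩ h
    have h' : τ p₁ hp₁ = τ p₂ hp₂ := congrArg Subtype.val h
    exact Subtype.ext ((hτinj p₂ hp₂ p₁ hp₁ (by rw [hτD p₁ hp₁, h'])))
  have hτ'bij : Function.Bijective τ' := Finite.injective_iff_bijective.mp hτ'inj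
  let σ : Equiv.Perm S := Equiv.ofBijective τ' hτ'bij
  obtain ⟨Nσ, hNσpos, hNσ⟩ : ∃ n : ℕ, 0 < n ∧ σ ^ n = 1 := ⟨orderOf σ, orderOf_pos σ, pow_orderOf_eq_one σ⟩
  -- iterates of `D` on the prime cycles of `S`
  have hiter : ∀ (m : ℕ) (p : S), (⇑D)^[m] (primeCycle p.1) = primeCycle ((σ ^ m) p).1 := by
    intro m
    induction m with
    | zero => intro p; rfl
    | succ m ih =>
      intro p
      rw [Function.iterate_succ_apply', ih, pow_succ', Equiv.Perm.mul_apply]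
      exact hτD _ ((σ ^ m) p).2
  have hiter_sum : ∀ (m : ℕ) (a : X.left → ℤ),
      (⇑D)^[m] (∑ p ∈ S.attach, a p.1 • primeCycle p.1) =
        ∑ p ∈ S.attach, a p.1 • (⇑D)^[m] (primeCycle p.1) := by
    intro m a
    induction m with
    | zero => rfl
    | succ m ih =>
      rw [Function.iterate_succ_apply', ih, map_sum]
      refine Finset.sum_congr rfl fun p _ ↦ ?_
      rw [map_zsmul, Function.iterate_succ_apply']
  have hxsum : x = ∑ p ∈ S.attach, x p.1 • primeCycle p.1 := by
    rw [Finset.sum_attach S (fun p ↦ x p • primeCycle p)]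
    exact eq_sum_smul_primeCycle x hS
  have hDN : (⇑D)^[Nσ] x = x := by
    conv_lhs => rw [hxsum]
    rw [hiter_sum]
    conv_rhs => rw [hxsum]
    refine Finset.sum_congr rfl fun p _ ↦ ?_
    rw [hiter, hNσ, Equiv.Perm.one_apply]
  -- `b • D^m x ∈ Rat` for all `m ≥ 1`
  have hstep : ∀ c : AlgebraicCycle X.left ℤ, b • E c ∈ ratTrivial Xb.left k →
      b • D c ∈ ratTrivial X.left k := by
    intro c hc
    have h := hMrat _ hc
    rwa [map_zsmul] at h
  have hall : ∀ m : ℕ, b • (⇑D)^[m + 1] x ∈ ratTrivial X.left k := by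
    intro m
    induction m with
    | zero => exact hstep x hb
    | succ m ih =>
      rw [Function.iterate_succ_apply']
      refine hstep _ ?_
      have h := hErat _ ih
      rwa [map_zsmul] at h
  obtain ⟨n, rfl⟩ := Nat.exists_eq_add_one_of_ne_zero hNσpos.ne'
  have h := hall n
  rwa [hDN] at h

end KernelTorsion

/-! ### The rank-one hypothesis transported to the geometric generic fibre (Vial's isomorphism) -/

section RankOneTransport

open Literature.AlgebraicGeometry.Limits

variable {C : Type} [Field C] [IsAlgClosed C] [CharZero C]

/-- **The rank-one hypothesis over `C`, transported to `X_Ω`.** Let `X` be a projective variety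
over an uncountable algebraically closed field `C` of characteristic `0` whose `k`-cycles have
rank `≤ 1` up to rational equivalence (`a • c ∼ b • c'`, `(a, b) ≠ (0, 0)`, for any two
`k`-cycles), and `Ω ⊇ j(C)` algebraically closed with `#Ω = #C`. Then every `k`-cycle `ζ` on
`X_Ω = X ×_{C,j} Spec Ω` satisfies `M • ζ ∼ w_Ω` for some `M ≠ 0` and some `k`-cycle `w` on `X`
DEFINED OVER `C`. Proof: by Vial's isomorphism `Ψ : X_Ω ≅ X` (`exists_iso_pullback_specMap_comp_eq`)
`ζ` becomes a `k`-cycle `x = Ψ_* ζ` on `X`; apply the hypothesis to `x` and `Ψ_*(x_Ω)`: either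
`a ≠ 0` and `a • ζ ∼ b • x_Ω` (transport back along `Ψ`), or `x_Ω`, hence `x`
(`zsmul_mem_ratTrivial_of_baseChange`), hence `ζ`, is torsion. This replaces, for `k`-cycles, the
very general point of the case `k = 0` (Voisin II, proof of Thm. 10.29: "we know that the kernel
of `cl : CH_{k₀}(X) → H^{2n-2k₀}(X, ℤ)` is torsion […] By a countability argument […]").
[cite: VoisinHodgeII2003, Thm. 10.29 (proof)] [cite: Vial2013, Lemma 2.1]
[cite: BlochLectures2010, Lemma 1A.3] -/
theorem exists_zsmul_sub_baseChange_mem_ratTrivial (hC : ℵ₀ < #C) (X : SchemeOver C)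
    [IsIntegral X.left] [LocallyOfFiniteType X.hom] [QuasiCompact X.hom] (hX : IsProjectiveOver X)
    {k : ℕ} (hH : ∀ c ∈ cyclesOfDim X.left k, ∀ c' ∈ cyclesOfDim X.left k,
      ∃ a b : ℤ, (a ≠ 0 ∨ b ≠ 0) ∧ IsRationallyEquivalent (a • c) (b • c') k)
    {Ω : Type} [Field Ω] [IsAlgClosed Ω] (j : C →+* Ω) (hΩ : #Ω = #C)
    (hπ : locallyFinsupp_flatPullbackFun_baseChangeHomFst.{0})
    {ζ : AlgebraicCycle ((baseChangeHom j).obj X).left ℤ}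
    (hζ : ζ ∈ cyclesOfDim ((baseChangeHom j).obj X).left k) :
    ∃ M : ℤ, M ≠ 0 ∧ ∃ w ∈ cyclesOfDim X.left k,
      M • ζ - AlgebraicCycle.baseChange j X hπ w ∈ ratTrivial ((baseChangeHom j).obj X).left k := by
  -- a countable model and Vial's isomorphism
  obtain ⟨t₀, N, X₀, hX₀, ι₀, hι₀, π₀, H₀, -⟩ :=
    exists_isPullback_specMap_of_isProjectiveOver ℚ C X hX isClosed_empty
  have hk₀ : #(IntermediateField.adjoin ℚ (t₀ : Set C)) ≤ ℵ₀ :=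
    cardinalMk_intermediateFieldAdjoin_le_aleph0 (by simp) t₀.finite_toSet
  let Xb : SchemeOver Ω := (baseChangeHom j).obj X
  let E : AlgebraicCycle X.left ℤ →+ AlgebraicCycle Xb.left ℤ := AlgebraicCycle.baseChange j X hπ
  obtain ⟨Ψ, -⟩ := exists_iso_pullback_specMap_comp_eq hC X hk₀ _ π₀ H₀ j hΩ
  let XbC : SchemeOver C := Over.mk (Ψ.hom ≫ X.hom)
  haveI : LocallyOfFiniteType XbC.hom := inferInstanceAs (LocallyOfFiniteType (Ψ.hom ≫ X.hom))
  let Mi : AlgebraicCycle X.left ℤ →+ AlgebraicCycle Xb.left ℤ :=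
    AddMonoidHom.mk' (AlgebraicCycle.map Ψ.inv height height) (algebraicCycleMap_add Ψ.inv _ _)
  have hMi : ∀ c, Mi c = AlgebraicCycle.map Ψ.inv height height c := fun _ ↦ rfl
  have hMirat : ∀ c ∈ ratTrivial X.left k, Mi c ∈ ratTrivial Xb.left k := fun c hc ↦
    algebraicCycleMap_hom_mem_ratTrivial X XbC Ψ.symm (by
      change Ψ.inv ≫ Ψ.hom ≫ X.hom = X.hom
      rw [Iso.inv_hom_id_assoc]) hc
  -- `x = Ψ_* ζ` and `Ψ_* (x_Ω)`
  set x := AlgebraicCycle.map Ψ.hom height height ζ with hxdef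
  have hx : x ∈ cyclesOfDim X.left k := (algebraicCycleMap_hom_mem_cyclesOfDim_iff Ψ ζ).mpr hζ
  have hEx : E x ∈ cyclesOfDim Xb.left k := AlgebraicCycle.baseChange_mem_cyclesOfDim_holds j X hπ hx
  have hDx : AlgebraicCycle.map Ψ.hom height height (E x) ∈ cyclesOfDim X.left k :=
    (algebraicCycleMap_hom_mem_cyclesOfDim_iff Ψ _).mpr hEx
  have hMix : Mi x = ζ := algebraicCycleMap_inv_map_hom Ψ ζ
  have hMiDx : Mi (AlgebraicCycle.map Ψ.hom height height (E x)) = E x :=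
    algebraicCycleMap_inv_map_hom Ψ _
  obtain ⟨a, b, hab, hrat⟩ := hH x hx _ hDx
  -- transport the relation to `X_Ω`
  have hrat' : a • ζ - b • E x ∈ ratTrivial Xb.left k := by
    have h := hMirat _ hrat
    rwa [map_sub, map_zsmul, map_zsmul, hMix, hMiDx] at h
  by_cases ha : a = 0
  · -- `x_Ω` is torsion, hence `x`, hence `ζ`
    subst ha
    have hb : b ≠ 0 := hab.resolve_left fun h ↦ h rfl
    have h1 : b • E x ∈ ratTrivial Xb.left k := by
      rw [zero_smul, zero_sub] at hrat'
      simpa using (ratTrivial Xb.left k).neg_mem hrat'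
    have h2 : b • x ∈ ratTrivial X.left k := zsmul_mem_ratTrivial_of_baseChange hC X hX j hΩ hπ hx h1
    have h3 : b • ζ ∈ ratTrivial Xb.left k := by
      have h := hMirat _ h2
      rwa [map_zsmul, hMix] at h
    refine ⟨b, hb, 0, zero_mem _, ?_⟩
    rwa [map_zero, sub_zero]
  · refine ⟨a, ha, b • x, AddSubgroup.zsmul_mem _ hx b, ?_⟩
    rwa [map_zsmul]

end RankOneTransport

/-! ### Step 2 of Voisin 2019, Prop. 2.2 for an integral combination of families (Bloch's limit argument) -/

section StepTwoSum

open CartesianMonoidalCategory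

variable {k : Type u} [Field k] {X T : SchemeOver k} [LocallyOfFiniteType X.hom] [QuasiCompact X.hom]
  [IsIntegral T.left]

/-- `f^*` on coefficient functions is additive: the bundled form used for sums. [folklore] -/
theorem flatPullbackFun_sum {X' Y' : Scheme.{u}} (f : X' ⟶ Y') {ι : Type*} (s : Finset ι)
    (c : ι → AlgebraicCycle Y' ℤ) :
    f.flatPullbackFun (∑ i ∈ s, c i) = ∑ i ∈ s, f.flatPullbackFun (c i) :=
  map_sum (AddMonoidHom.mk' f.flatPullbackFun (flatPullbackFun_add f)) c s

/-- `f^*` on coefficient functions commutes with integer multiples. [folklore] -/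
theorem flatPullbackFun_zsmul {X' Y' : Scheme.{u}} (f : X' ⟶ Y') (m : ℤ) (c : AlgebraicCycle Y' ℤ) :
    f.flatPullbackFun (m • c) = m • f.flatPullbackFun c :=
  map_zsmul (AddMonoidHom.mk' f.flatPullbackFun (flatPullbackFun_add f)) m c

/-- **Bloch's limit argument (Lemma 1A.3, proof: "The case `K'` algebraic over `K` follows by a
limit argument") for an integral combination `Σ nᵢ [𝒲ᵢ]` of families of closed subschemes
`𝒲ᵢ ↪ X ×ₖ T` over an integral base**: if `Σ nᵢ [𝒲ᵢ,η_Ω] ∈ Rat_d(X ×ₖ Spec Ω)` for some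
ALGEBRAIC extension `Ω ⊇ k(T)`, then `Σ nᵢ [𝒲ᵢ,η_L] ∈ Rat_d(X ×ₖ Spec L)` for some FINITE
extension `L ⊇ k(T)`. The proof is that of `Bloch1980_genericFibreRatTrivial_finiteExt_holds`
(one family, `T` smooth projective — of which only the integrality of `T` is used): the identity
exhibiting rational triviality over `Ω` comes from a finite stage `E₁ ⊆ Ω`
(`FiniteExtTower.ratTrivial_descent_eventually`), where it already holds because flat pull-back
along `X ×ₖ Spec Ω → X ×ₖ Spec E₁` is injective on cycles and maps each `[𝒲ᵢ,η_{E₁}]` to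
`[𝒲ᵢ,η_Ω]`. [cite: BlochLectures2010, Lemma 1A.3 (proof)]
[cite: Voisin2019BirationalDiagonal, Prop. 2.2] -/
theorem genericFibreRatTrivial_finiteExt_of_algExt_sum {ι : Type*} (s : Finset ι) (n : ι → ℤ)
    (𝒲 : ι → ClosedSubscheme (X ⊗ T).left) [∀ i, IsLocallyNoetherian (𝒲 i).carrier]
    (hZ : locallyFinsupp_fundamentalCycleFun.{u}) (d : ℕ)
    {Ω : Type u} [Field Ω] [Algebra T.left.functionField Ω]
    [Algebra.IsAlgebraic T.left.functionField Ω]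
    (hΩ : (∑ i ∈ s, n i • (familyFiberOver (𝒲 i) (Resolution.fromSpecExtension T.left Ω)).cycle hZ) ∈
      ratTrivial (X ⊗ ptOver T (Resolution.fromSpecExtension T.left Ω)).left d) :
    ∃ (L : Type u) (_ : Field L) (_ : Algebra T.left.functionField L),
      FiniteDimensional T.left.functionField L ∧
      (∑ i ∈ s, n i • (familyFiberOver (𝒲 i) (Resolution.fromSpecExtension T.left L)).cycle hZ) ∈
        ratTrivial (X ⊗ ptOver T (Resolution.fromSpecExtension T.left L)).left d := by
  set F := T.left.functionField
  -- the tower of generic fibres `X_E = X ×_k Spec E` over the intermediate fields `E` of `Ω / F`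
  let η : ∀ (L : Type u) [Field L] [Algebra F L], Spec (.of L) ⟶ T.left :=
    fun L _ _ => Resolution.fromSpecExtension T.left L
  let P : ∀ (L : Type u) [Field L] [Algebra F L], SchemeOver k := fun L _ _ => ptOver T (η L)
  let E₀ : IntermediateField F Ω := ⊥
  have hΩE : ∀ E : IntermediateField F Ω,
      (algebraMap E Ω).comp (algebraMap F E) = algebraMap F Ω := fun E =>
    (IsScalarTower.algebraMap_eq F E Ω).symm
  have hEE : ∀ {E E' : IntermediateField F Ω} (h : E ≤ E'),
      (IntermediateField.inclusion h).toRingHom.comp (algebraMap F E) = algebraMap F E' := fun h =>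
    (IntermediateField.inclusion h).comp_algebraMap
  have hgΩ : ∀ E : IntermediateField F Ω, ∃ g : P Ω ⟶ P E,
      g.left = Spec.map (CommRingCat.ofHom (algebraMap E Ω)) ∧
      g ≫ ptOverι T (η E) = ptOverι T (η Ω) := fun E => exists_ptOverHom (algebraMap E Ω) (hΩE E)
  choose gΩ hgΩl hgΩι using hgΩ
  have hgLE : ∀ (E E' : IntermediateField F Ω) (h : E ≤ E'), ∃ g : P E' ⟶ P E,
      g.left = Spec.map (CommRingCat.ofHom (IntermediateField.inclusion h).toRingHom) ∧
      g ≫ ptOverι T (η E) = ptOverι T (η E') := fun E E' h =>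
    exists_ptOverHom (IntermediateField.inclusion h).toRingHom (hEE h)
  choose gLE hgLEl _ using hgLE
  -- the presentation of the tower: base `M = X_⊥`, `M_K = X_Ω`
  let M : Scheme.{u} := (X ⊗ P E₀).left
  let m : M ⟶ Spec (.of E₀) := (snd X (P E₀)).left
  haveI : LocallyOfFiniteType m := inferInstanceAs (LocallyOfFiniteType (pullback.snd X.hom _))
  haveI : QuasiCompact m := inferInstanceAs (QuasiCompact (pullback.snd X.hom _))
  have hK : IsPullback (X ◁ gΩ E₀).left (snd X (P Ω)).left m
      (Spec.map (CommRingCat.ofHom (algebraMap E₀ Ω))) := by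
    rw [← hgΩl E₀]
    exact isPullback_whiskerLeft X (gΩ E₀)
  -- the descent
  obtain ⟨E₁, -, hfin, H⟩ := FiniteExtTower.ratTrivial_descent_eventually m hK hΩ
  haveI := hfin
  have hsq : IsPullback (X ◁ gLE E₀ E₁ bot_le).left (snd X (P E₁)).left m
      (Spec.map (CommRingCat.ofHom (IntermediateField.inclusion (bot_le : E₀ ≤ E₁)).toRingHom)) := by
    rw [← hgLEl E₀ E₁ bot_le]
    exact isPullback_whiskerLeft X (gLE E₀ E₁ bot_le)
  have hr₁ : (X ◁ gΩ E₁).left ≫ (X ◁ gLE E₀ E₁ bot_le).left = (X ◁ gΩ E₀).left := by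
    rw [← Over.comp_left, ← MonoidalCategory.whiskerLeft_comp]
    congr 2
    ext : 1
    rw [Over.comp_left, hgΩl, hgLEl, hgΩl]
    exact Resolution.specTo_comp_specLE (bot_le : E₀ ≤ E₁)
  have hr₂ : (X ◁ gΩ E₁).left ≫ (snd X (P E₁)).left =
      (snd X (P Ω)).left ≫ Spec.map (CommRingCat.ofHom (algebraMap E₁ Ω)) := by
    rw [← Over.comp_left, whiskerLeft_snd, Over.comp_left, hgΩl]
    rfl
  obtain ⟨c', hc', hc'c⟩ := H E₁ le_rfl hfin bot_le _ _ _ hsq _ hr₁ hr₂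
  -- `r^*[𝒲ᵢ,η_E] = [𝒲ᵢ,η_Ω]`, so `c' = Σ nᵢ [𝒲ᵢ,η_E]` by injectivity
  set r := (X ◁ gΩ E₁).left with hr
  have hr' := FiniteExtTower.isPullback_transition m hK bot_le hsq hr₁ hr₂
  obtain ⟨_, hrflat, hrsurj⟩ := Resolution.isAffineHom_flat_surjective_of_isPullback hr'
  have hcyc : ∀ i, r.flatPullbackFun ((familyFiberOver (𝒲 i) (η E₁)).cycle hZ) =
      ⇑((familyFiberOver (𝒲 i) (η Ω)).cycle hZ) := by
    intro i
    rw [flatPullbackFun_cycle r hZ]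
    congr 1
    have h : r ≫ (X ◁ ptOverι T (η E₁)).left = (X ◁ ptOverι T (η Ω)).left := by
      rw [hr, ← Over.comp_left, ← MonoidalCategory.whiskerLeft_comp, hgΩι]
    refine ClosedSubscheme.cycle_eq_of_iso _ _
      (pullbackLeftPullbackSndIso (𝒲 i).ι (X ◁ ptOverι T (η E₁)).left r ≪≫ pullback.congrHom rfl h)
      ?_ hZ
    change (_ ≫ _) ≫ pullback.snd _ _ =
      pullback.snd (pullback.snd (𝒲 i).ι (X ◁ ptOverι T (η E₁)).left) r
    rw [Category.assoc, pullback.congrHom_hom, pullback.lift_snd, Category.comp_id]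
    exact pullbackLeftPullbackSndIso_hom_snd _ _ _
  have hsum : r.flatPullbackFun
      (∑ i ∈ s, n i • (familyFiberOver (𝒲 i) (η E₁)).cycle hZ) =
      ⇑(∑ i ∈ s, n i • (familyFiberOver (𝒲 i) (η Ω)).cycle hZ) := by
    rw [flatPullbackFun_sum, Function.locallyFinsuppWithin.coe_sum]
    refine Finset.sum_congr rfl fun i _ ↦ ?_
    rw [flatPullbackFun_zsmul, hcyc i, Function.locallyFinsuppWithin.coe_zsmul]
  have hc'eq : c' = ∑ i ∈ s, n i • (familyFiberOver (𝒲 i) (η E₁)).cycle hZ :=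
    flatPullbackFun_injective r (hc'c.trans hsum.symm)
  refine ⟨E₁, inferInstance, inferInstance, hfin, ?_⟩
  change (∑ i ∈ s, n i • (familyFiberOver (𝒲 i) (η E₁)).cycle hZ) ∈ ratTrivial _ d
  rw [← hc'eq]
  exact hc'

end StepTwoSum

/-! ### Step 3 of Voisin 2019, Prop. 2.2 (spreading out over the normalisation) for an integral combination of families -/

section StepThreeSum

open CartesianMonoidalCategory

variable {k : Type u} [Field k] {X T S : SchemeOver k}

/-- **From "`Σ nᵢ [𝒲ᵢ,q₀ ≫ g]` vanishes" to rational triviality over a dense open of a cover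
`S → T` with `k(S) = L`** — the sum form of
`exists_flatPullback_ι_mem_ratTrivial_of_familyFibreRatTrivialOver_comp` (Voisin 2019, proof of
Prop. 2.2; Bloch, Lemma 1A.1): each fibre cycle over `q₀ ≫ g` is the restriction to the generic
fibre of `X ×ₖ S` of the pulled-back family (`familyFiberOver_comp_cycle`), restriction is
additive, and Bloch's Lemma 1A.1 is cycle-level
(`exists_flatPullback_ι_mem_ratTrivial_of_algebraicCycleComap_mem`).
[cite: Voisin2019BirationalDiagonal, Prop. 2.2] [cite: BlochLectures2010, Lemma 1A.1] -/
theorem exists_flatPullback_ι_mem_ratTrivial_of_familyFibre_sum_comp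
    [IsIntegral S.left] [LocallyOfFiniteType X.hom] [QuasiCompact X.hom]
    [LocallyOfFiniteType S.hom] [QuasiCompact S.hom] [IsLocallyNoetherian (X ⊗ T).left]
    [IsLocallyNoetherian (X ⊗ S).left]
    (g : S ⟶ T) {R : CommRingCat.{u}} [IsNoetherianRing R] (q₀ : Spec R ⟶ S.left) [Flat q₀]
    [IsPreimmersion q₀] [QuasiCompact q₀] (hq₀ : Set.range q₀ = {genericPoint S.left})
    {ι : Type*} (s : Finset ι) (n : ι → ℤ) (𝒲 : ι → ClosedSubscheme (X ⊗ T).left)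
    (hZ : locallyFinsupp_fundamentalCycleFun.{u})
    (hf : locallyFinsupp_flatPullbackFun.{u}) {d e : ℕ} (he : height (genericPoint S.left) = e)
    (h : (∑ i ∈ s, n i • (familyFiberOver (𝒲 i) (q₀ ≫ g.left)).cycle hZ) ∈
      ratTrivial (X ⊗ ptOver T (q₀ ≫ g.left)).left d) :
    ∃ U'' : S.left.Opens, (U'' : Set S.left).Nonempty ∧
      flatPullback ((CartesianMonoidalCategory.snd X S).left ⁻¹ᵁ U'').ι hf
          (∑ i ∈ s, n i • ((𝒲 i).preimage (X ◁ g).left).cycle hZ) ∈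
        ratTrivial (↑((CartesianMonoidalCategory.snd X S).left ⁻¹ᵁ U'') : Scheme.{u}) (d + e) := by
  have hP : IsPullback (X ◁ (Over.homMk q₀ (ptOverLift_w g q₀) : ptOver T _ ⟶ S)).left
      (CartesianMonoidalCategory.snd X (ptOver T (q₀ ≫ g.left))).left
      (CartesianMonoidalCategory.snd X S).left q₀ :=
    isPullback_whiskerLeft X (Over.homMk q₀ (ptOverLift_w g q₀) : ptOver T _ ⟶ S)
  haveI : @Flat (ptOver T (q₀ ≫ g.left)).left S.left q₀ := ‹Flat q₀›
  haveI : @IsPreimmersion (ptOver T (q₀ ≫ g.left)).left S.left q₀ := ‹IsPreimmersion q₀›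
  haveI : @QuasiCompact (ptOver T (q₀ ≫ g.left)).left S.left q₀ := ‹QuasiCompact q₀›
  haveI hpre : IsPreimmersion
      (X ◁ (Over.homMk q₀ (ptOverLift_w g q₀) : ptOver T (q₀ ≫ g.left) ⟶ S)).left :=
    MorphismProperty.of_isPullback hP.flip (show IsPreimmersion q₀ from inferInstance)
  have hc := h
  have hrw : (∑ i ∈ s, n i • (familyFiberOver (𝒲 i) (q₀ ≫ g.left)).cycle hZ) =
      algebraicCycleComap (X ◁ (Over.homMk q₀ (ptOverLift_w g q₀) : ptOver T _ ⟶ S)).left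
        (X ◁ (Over.homMk q₀ (ptOverLift_w g q₀) : ptOver T _ ⟶ S)).left.isEmbedding.injective
        (∑ i ∈ s, n i • ((𝒲 i).preimage (X ◁ g).left).cycle hZ) := by
    rw [← algebraicCycleComapHom_apply, map_sum]
    refine Finset.sum_congr rfl fun i _ ↦ ?_
    rw [map_zsmul, algebraicCycleComapHom_apply, familyFiberOver_comp_cycle g q₀ (𝒲 i) hZ]
  rw [hrw] at hc
  exact exists_flatPullback_ι_mem_ratTrivial_of_algebraicCycleComap_mem hP hq₀ hf he hc

/-- **Voisin 2019, Prop. 2.2, step 3 for an integral combination `Z = Σ nᵢ [𝒲ᵢ]` of families of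
closed subschemes `𝒲ᵢ ↪ X ×ₖ T` over an INTEGRAL base `T` of finite type and dimension `e`** (the
proof of `Voisin2019_genericFibreRatTrivial_spread_holds`, which uses of its smooth projective base
only integrality, finite type and the dimension, run for the sum): if
`Σ nᵢ [𝒲ᵢ,η_L] ∈ Rat_d(X ×ₖ Spec L)` for a finite extension `L ⊇ k(T)`, there are a non-empty open
`U ⊆ T` and a finite flat `p : U' → U` of constant positive degree such that the flat pull-back to
`U' ×_U (X × U)` of `Z_{|X × U}` lies in `Rat_{d+e}` — normalisation `T^L` of `T` in `L`, spreading
out from its generic point, generic flatness of `T^L → T`, shrinking, and Fulton's Lemma 1.7.1 /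
Thm. 1.7 for the open immersion `U' ×_U (X × U) ↪ X × U''`.
[cite: Voisin2019BirationalDiagonal, Thm. 2.1 (proof) and Prop. 2.2]
[cite: BlochLectures2010, Lemma 1A.1] [cite: Fulton1998, Lemma 1.7.1 and Theorem 1.7] -/
theorem genericFibreRatTrivial_spread_sum [LocallyOfFiniteType X.hom] [QuasiCompact X.hom]
    [IsIntegral X.left] [IsIntegral T.left] [LocallyOfFiniteType T.hom] [QuasiCompact T.hom]
    {e : ℕ} (he : height (genericPoint T.left) = e)
    {ι : Type*} (s : Finset ι) (n : ι → ℤ) (𝒲 : ι → ClosedSubscheme (X ⊗ T).left)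
    [∀ i, IsLocallyNoetherian (𝒲 i).carrier]
    (hZ : locallyFinsupp_fundamentalCycleFun.{u}) (hf : locallyFinsupp_flatPullbackFun.{u}) (d : ℕ)
    {L : Type u} [Field L] [Algebra T.left.functionField L] [FiniteDimensional T.left.functionField L]
    (hrat₀ : (∑ i ∈ s, n i • (familyFiberOver (𝒲 i) (Resolution.fromSpecExtension T.left L)).cycle hZ) ∈
      ratTrivial (X ⊗ ptOver T (Resolution.fromSpecExtension T.left L)).left d) :
    ∃ U : T.left.Opens, (U : Set T.left).Nonempty ∧
      ∃ (U' : Scheme.{u}) (p : U' ⟶ (U : Scheme.{u})) (_ : IsFinite p) (_ : Flat p),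
        (∃ N : ℕ, 0 < N ∧ ∀ u : U, p.finrank u = N) ∧
        flatPullback (pullback.fst ((CartesianMonoidalCategory.snd X T).left ∣_ U) p) hf
            (flatPullback ((CartesianMonoidalCategory.snd X T).left ⁻¹ᵁ U).ι hf
              (∑ i ∈ s, n i • (𝒲 i).cycle hZ)) ∈
          ratTrivial (pullback ((CartesianMonoidalCategory.snd X T).left ∣_ U) p) (d + e) := by
  haveI : LocallyOfFiniteType (X ⊗ T).hom :=
    inferInstanceAs (LocallyOfFiniteType (pullback.fst X.hom T.hom ≫ X.hom))
  haveI : QuasiCompact (X ⊗ T).hom :=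
    inferInstanceAs (QuasiCompact (pullback.fst X.hom T.hom ≫ X.hom))
  haveI : IsLocallyNoetherian (X ⊗ T).left := LocallyOfFiniteType.isLocallyNoetherian (X ⊗ T).hom
  haveI : IsLocallyNoetherian T.left := LocallyOfFiniteType.isLocallyNoetherian T.hom
  have hrat := hrat₀
  -- the normalisation `T^L` of `T` in `L`, a finite cover `ν : T^L → T`
  let T' : SchemeOver k := Over.mk (Resolution.normalizationInι T.left L ≫ T.hom)
  set ν : T'.left ⟶ T.left := Resolution.normalizationInι T.left L with hν
  let ν' : T' ⟶ T := Over.homMk ν rfl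
  haveI : IsIntegral T'.left := inferInstanceAs (IsIntegral (Resolution.normalizationIn T.left L))
  haveI : IsFinite ν := Resolution.isFinite_normalizationInι T.left L T.hom
  haveI : Surjective ν := Resolution.surjective_normalizationInι T.left L
  haveI : IsDominant ν := inferInstanceAs (IsDominant (Resolution.normalizationInι T.left L))
  haveI : LocallyOfFiniteType T'.hom := inferInstanceAs (LocallyOfFiniteType (ν ≫ T.hom))
  haveI : QuasiCompact T'.hom := inferInstanceAs (QuasiCompact (ν ≫ T.hom))
  -- its generic point, presented by `Spec L → T^L` (`K(T^L) = L`)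
  set q₀ : Spec (.of L) ⟶ T'.left := (Resolution.fromSpecExtension T.left L).toNormalization
    with hq₀
  haveI : Flat q₀ := Resolution.flat_toNormalization T.left L
  haveI : IsPreimmersion q₀ := Resolution.isPreimmersion_toNormalization T.left L
  haveI : QuasiCompact q₀ :=
    inferInstanceAs (QuasiCompact (Resolution.fromSpecExtension T.left L).toNormalization)
  have hq₀r : Set.range q₀ = {genericPoint T'.left} := Resolution.range_toNormalization T.left L
  have hνη : ν (genericPoint T'.left) = genericPoint T.left :=
    Morphisms.base_genericPoint_eq ν ν.denseRange
  have he' : height (genericPoint T'.left) = e := by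
    rw [← he, ← hνη]
    exact (height_base_eq_of_isFinite ν _).symm
  have hfac : Resolution.fromSpecExtension T.left L = q₀ ≫ ν'.left :=
    (Scheme.Hom.toNormalization_fromNormalization _).symm
  rw [hfac] at hrat
  haveI : LocallyOfFiniteType (X ⊗ T').hom :=
    inferInstanceAs (LocallyOfFiniteType (pullback.fst X.hom T'.hom ≫ X.hom))
  haveI : QuasiCompact (X ⊗ T').hom :=
    inferInstanceAs (QuasiCompact (pullback.fst X.hom T'.hom ≫ X.hom))
  haveI : IsLocallyNoetherian (X ⊗ T').left :=
    LocallyOfFiniteType.isLocallyNoetherian (X ⊗ T').hom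
  -- spreading out over `T^L` (Bloch, Lemma 1A.1)
  obtain ⟨U'', hU'', hspread⟩ :=
    exists_flatPullback_ι_mem_ratTrivial_of_familyFibre_sum_comp ν' q₀ hq₀r s n 𝒲 hZ hf he' hrat
  -- generic flatness of `ν`, and shrinking: `U ⊆ U₀` non-empty with `ν⁻¹ U ⊆ U''`
  obtain ⟨U₀, hU₀, hflat₀⟩ := Morphisms.exists_nonempty_flat_morphismRestrict_of_isFinite ν
  have hηU₀ : genericPoint T.left ∈ U₀ :=
    ((genericPoint_spec T.left).mem_open_set_iff U₀.isOpen).mpr (by simpa using hU₀)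
  have hηU'' : genericPoint T'.left ∈ U'' :=
    ((genericPoint_spec T'.left).mem_open_set_iff U''.isOpen).mpr (by simpa using hU'')
  obtain ⟨U₁, hU₁, hle⟩ := Morphisms.exists_opens_preimage_le_of_isFinite ν (U'' ⊓ ν ⁻¹ᵁ U₀)
    ⟨genericPoint T'.left, hηU'', show ν (genericPoint T'.left) ∈ U₀ by rwa [hνη]⟩
  have hηU₁ : genericPoint T.left ∈ U₁ :=
    ((genericPoint_spec T.left).mem_open_set_iff U₁.isOpen).mpr (by simpa using hU₁)
  set U : T.left.Opens := U₀.ι ''ᵁ (U₀.ι ⁻¹ᵁ U₁) with hU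
  have hUU₀ : U ≤ U₀ := U₀.ι_image_le _
  have hUU₁ : U ≤ U₁ := U₀.ι.image_preimage_le U₁
  have hηU : genericPoint T.left ∈ U := ⟨⟨genericPoint T.left, hηU₀⟩, hηU₁, rfl⟩
  have hνU : ν ⁻¹ᵁ U ≤ U'' := fun t ht ↦ (hle (show t ∈ ν ⁻¹ᵁ U₁ from hUU₁ ht)).1
  -- the finite flat cover `p = ν|_U : U' = ν⁻¹(U) → U`, of constant positive degree
  haveI hpflat : Flat (ν ∣_ U) := by
    haveI := hflat₀
    have h1 : Flat ((ν ∣_ U₀) ∣_ (U₀.ι ⁻¹ᵁ U₁)) := inferInstance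
    exact (MorphismProperty.arrow_mk_iso_iff @Flat (morphismRestrictRestrict ν U₀ (U₀.ι ⁻¹ᵁ U₁))).mp
      h1
  haveI : Nonempty (U : Scheme.{u}) := ⟨⟨genericPoint T.left, hηU⟩⟩
  haveI : IsIntegral (U : Scheme.{u}) := isIntegral_of_isOpenImmersion U.ι
  haveI : Surjective (ν ∣_ U) := IsZariskiLocalAtTarget.restrict ‹Surjective ν› U
  obtain ⟨N, hN, hrank⟩ := Morphisms.exists_pos_finrank_eq_of_preconnectedSpace (ν ∣_ U)
  refine ⟨U, ⟨genericPoint T.left, hηU⟩, ↑(ν ⁻¹ᵁ U), ν ∣_ U, inferInstance, hpflat, ⟨N, hN, hrank⟩,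
    ?_⟩
  -- `Y_{U'} = U' ×_U (X × U)` as an open subscheme of `X × U'' ⊆ X × T^L`
  set pr₂ := (CartesianMonoidalCategory.snd X T).left with hpr₂
  set pr₂' := (CartesianMonoidalCategory.snd X T').left with hpr₂'
  set V : (X ⊗ T).left.Opens := pr₂ ⁻¹ᵁ U with hV
  set W'' : (X ⊗ T').left.Opens := pr₂' ⁻¹ᵁ U'' with hW''
  set p'' := pullback.fst (pr₂ ∣_ U) (ν ∣_ U) with hp''
  have Hsq : IsPullback (X ◁ ν').left pr₂' pr₂ ν := isPullback_whiskerLeft X ν'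
  let ψ₁ : pullback (pr₂ ∣_ U) (ν ∣_ U) ⟶ pullback pr₂ ν :=
    pullback.map (pr₂ ∣_ U) (ν ∣_ U) pr₂ ν V.ι (ν ⁻¹ᵁ U).ι U.ι (morphismRestrict_ι pr₂ U)
      (morphismRestrict_ι ν U)
  let ψ₂ : pullback (pr₂ ∣_ U) (ν ∣_ U) ⟶ (X ⊗ T').left := ψ₁ ≫ Hsq.isoPullback.inv
  have hψ₂fst : ψ₂ ≫ (X ◁ ν').left = p'' ≫ V.ι := by
    simp only [ψ₂, ψ₁, Category.assoc, IsPullback.isoPullback_inv_fst, pullback.lift_fst]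
    rfl
  have hψ₂snd : ψ₂ ≫ pr₂' = pullback.snd (pr₂ ∣_ U) (ν ∣_ U) ≫ (ν ⁻¹ᵁ U).ι := by
    simp only [ψ₂, ψ₁, Category.assoc, IsPullback.isoPullback_inv_snd, pullback.lift_snd]
  have hrange : Set.range ψ₂ ⊆ Set.range W''.ι := by
    rintro _ ⟨y, rfl⟩
    rw [Scheme.Opens.range_ι]
    show pr₂' (ψ₂ y) ∈ U''
    rw [← Scheme.Hom.comp_apply, hψ₂snd, Scheme.Hom.comp_apply]
    exact hνU (pullback.snd (pr₂ ∣_ U) (ν ∣_ U) y).2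
  set ψ : pullback (pr₂ ∣_ U) (ν ∣_ U) ⟶ (W'' : Scheme.{u}) := IsOpenImmersion.lift W''.ι ψ₂ hrange
    with hψdef
  have hψ : ψ ≫ W''.ι = ψ₂ := IsOpenImmersion.lift_fac _ _ _
  haveI : IsOpenImmersion ψ := by
    haveI : IsOpenImmersion (ψ ≫ W''.ι) := by rw [hψ]; infer_instance
    exact IsOpenImmersion.of_comp ψ W''.ι
  -- Fulton's Thm. 1.7 for the open immersion `ψ : Y_{U'} → X × U''`
  let Wo : SchemeOver k := Over.mk (W''.ι ≫ (X ⊗ T').hom)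
  let Yo : SchemeOver k := Over.mk (ψ ≫ W''.ι ≫ (X ⊗ T').hom)
  let ψo : Yo ⟶ Wo := Over.homMk ψ rfl
  haveI : LocallyOfFiniteType Wo.hom :=
    inferInstanceAs (LocallyOfFiniteType (W''.ι ≫ (X ⊗ T').hom))
  haveI : QuasiCompact Wo.hom := inferInstanceAs (QuasiCompact (W''.ι ≫ (X ⊗ T').hom))
  haveI : Flat ψo.left := inferInstanceAs (Flat ψ)
  haveI : LocallyOfFiniteType ψo.left := inferInstanceAs (LocallyOfFiniteType ψ)
  haveI : QuasiCompact ψo.left := inferInstanceAs (QuasiCompact ψ)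
  have he0 : ψo.left.IsEquidimensional 0 := isEquidimensional_zero_of_isOpenImmersion ψ
  have hrat' := flatPullback_mem_ratTrivial_of_finiteType_holds ψo hf he0 hspread
  change flatPullback ψ hf (flatPullback W''.ι hf
      (∑ i ∈ s, n i • ((𝒲 i).preimage (X ◁ ν').left).cycle hZ)) ∈
    ratTrivial (pullback (pr₂ ∣_ U) (ν ∣_ U)) (d + e) at hrat'
  -- both cycles are `Σ nᵢ [𝒲ᵢ ×_{X × T} Y_{U'}]` (Fulton, Lemma 1.7.1)
  haveI : IsLocallyNoetherian (pullback (pr₂ ∣_ U) (ν ∣_ U)) :=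
    LocallyOfFiniteType.isLocallyNoetherian ψ
  have hcomp : (ψ ≫ W''.ι) ≫ (X ◁ ν').left = p'' ≫ V.ι := by rw [hψ, hψ₂fst]
  have hone : ∀ i, flatPullback p'' hf (flatPullback V.ι hf ((𝒲 i).cycle hZ)) =
      flatPullback ψ hf (flatPullback W''.ι hf (((𝒲 i).preimage (X ◁ ν').left).cycle hZ)) := by
    intro i
    rw [← flatPullback_comp_holds p'' V.ι hf ((𝒲 i).cycle hZ), ← flatPullback_comp_holds ψ W''.ι hf,
      flatPullback_cycle_eq_cycle_preimage_holds (p'' ≫ V.ι) hf hZ (𝒲 i),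
      flatPullback_cycle_eq_cycle_preimage_holds (ψ ≫ W''.ι) hf hZ ((𝒲 i).preimage (X ◁ ν').left)]
    symm
    refine ClosedSubscheme.cycle_eq_of_iso _ _ ?_ ?_ hZ
    · exact pullbackLeftPullbackSndIso (𝒲 i).ι (X ◁ ν').left (ψ ≫ W''.ι) ≪≫
        pullback.congrHom rfl hcomp
    · change (_ ≫ _) ≫ pullback.snd _ _ = pullback.snd _ _
      simp only [Category.assoc, pullback.congrHom_hom, pullback.lift_snd, Category.comp_id]
      exact pullbackLeftPullbackSndIso_hom_snd _ _ _
  convert hrat' using 1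
  simp only [map_sum, map_zsmul]
  exact Finset.sum_congr rfl fun i _ ↦ by rw [hone i]


end StepThreeSum

/-! ### The Bloch–Srinivas principle for an integral combination of families over an integral base (trace argument) -/

section PrincipleSum

variable {k : Type u} [Field k] {X T : SchemeOver k}

/-- **The Bloch–Srinivas principle for `Z = Σ nᵢ [𝒲ᵢ]` over an integral base of finite type,
from "`Z` vanishes in `CH(Y_{η_Ω})` for some ALGEBRAIC `Ω ⊇ k(T)`"** (Voisin 2019, Thm. 2.1 /
Prop. 2.2 / Thm. 2.3, the trace argument; the assembly `principle_of_genericFibreRatTrivialOverAlgExt`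
of the case `k₀ = 0`, run for sums over an integral finite-type base): Step 2
(`genericFibreRatTrivial_finiteExt_of_algExt_sum`), Step 3 (`genericFibreRatTrivial_spread_sum`),
then `N • Z_{|X×U} = p'_* p'^* Z_{|X×U}` (Fulton, Example 1.7.4,
`Fulton1998_finiteFlat_map_flatPullback_holds`) is rationally trivial (Fulton, Thm. 1.4).
[cite: Voisin2019BirationalDiagonal, Thm. 2.1 (proof), Prop. 2.2 and Thm. 2.3]
[cite: Fulton1998, Example 1.7.4 and Theorem 1.4] -/
theorem principle_sum_of_algExt [LocallyOfFiniteType X.hom] [QuasiCompact X.hom]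
    [IsIntegral X.left] [IsIntegral T.left] [LocallyOfFiniteType T.hom] [QuasiCompact T.hom]
    {e : ℕ} (he : height (genericPoint T.left) = e)
    {ι : Type*} (s : Finset ι) (n : ι → ℤ) (𝒲 : ι → ClosedSubscheme (X ⊗ T).left)
    [∀ i, IsLocallyNoetherian (𝒲 i).carrier]
    (hZ : locallyFinsupp_fundamentalCycleFun.{u}) (hf : locallyFinsupp_flatPullbackFun.{u}) (d : ℕ)
    {Ω : Type u} [Field Ω] [Algebra T.left.functionField Ω]
    [Algebra.IsAlgebraic T.left.functionField Ω]
    (hΩ : (∑ i ∈ s, n i • (familyFiberOver (𝒲 i) (Resolution.fromSpecExtension T.left Ω)).cycle hZ) ∈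
      ratTrivial (X ⊗ ptOver T (Resolution.fromSpecExtension T.left Ω)).left d) :
    ∃ N : ℕ, 0 < N ∧ ∃ U : T.left.Opens, (U : Set T.left).Nonempty ∧
      flatPullback ((CartesianMonoidalCategory.snd X T).left ⁻¹ᵁ U).ι hf
          (N • ∑ i ∈ s, n i • (𝒲 i).cycle hZ) ∈
        ratTrivial (↑((CartesianMonoidalCategory.snd X T).left ⁻¹ᵁ U) : Scheme.{u}) (d + e) := by
  obtain ⟨L, _, _, hfinL, hL⟩ := genericFibreRatTrivial_finiteExt_of_algExt_sum s n 𝒲 hZ d hΩ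
  haveI := hfinL
  obtain ⟨U, hU, U', p, hpfin, hpflat, ⟨N, hN, hrank⟩, hrat⟩ :=
    genericFibreRatTrivial_spread_sum he s n 𝒲 hZ hf d hL
  refine ⟨N, hN, U, hU, ?_⟩
  -- the objects of the printed proof: `X × U`, `q = pr₂ : X × U → U`, `p' : Y_{U'} → X × U`
  set pr₂ := (CartesianMonoidalCategory.snd X T).left with hpr₂
  set V : (X ⊗ T).left.Opens := pr₂ ⁻¹ᵁ U with hV
  set q : (V : Scheme.{u}) ⟶ (U : Scheme.{u}) := pr₂ ∣_ U with hq
  set p' : pullback q p ⟶ (V : Scheme.{u}) := pullback.fst q p with hp'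
  set c : AlgebraicCycle (V : Scheme.{u}) ℤ := flatPullback V.ι hf (∑ i ∈ s, n i • (𝒲 i).cycle hZ)
    with hc
  -- `X × U` and `Y_{U'}` as schemes of finite type over `k`, `p'` as a `k`-morphism
  haveI : LocallyOfFiniteType (X ⊗ T).hom :=
    inferInstanceAs (LocallyOfFiniteType (pullback.fst X.hom T.hom ≫ X.hom))
  haveI : QuasiCompact (X ⊗ T).hom :=
    inferInstanceAs (QuasiCompact (pullback.fst X.hom T.hom ≫ X.hom))
  haveI : IsLocallyNoetherian (X ⊗ T).left := LocallyOfFiniteType.isLocallyNoetherian (X ⊗ T).hom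
  let V' : SchemeOver k := Over.mk (V.ι ≫ (X ⊗ T).hom)
  let Y' : SchemeOver k := Over.mk (p' ≫ V.ι ≫ (X ⊗ T).hom)
  let f' : Y' ⟶ V' := Over.homMk p' rfl
  haveI : LocallyOfFiniteType V'.hom := inferInstanceAs (LocallyOfFiniteType (V.ι ≫ (X ⊗ T).hom))
  haveI : QuasiCompact V'.hom := inferInstanceAs (QuasiCompact (V.ι ≫ (X ⊗ T).hom))
  haveI : LocallyOfFiniteType Y'.hom :=
    inferInstanceAs (LocallyOfFiniteType (p' ≫ V.ι ≫ (X ⊗ T).hom))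
  haveI : IsFinite f'.left := inferInstanceAs (IsFinite p')
  haveI : Flat f'.left := inferInstanceAs (Flat p')
  haveI : IsProper f'.left := inferInstanceAs (IsProper p')
  -- `p'` has the constant degree `N` of `p`
  have hrank' : ∀ y : V'.left, f'.left.finrank y = N := fun y ↦ by
    change (pullback.fst q p).finrank y = N
    rw [Scheme.Hom.finrank_pullback_fst, hrank]
  -- Fulton Thm. 1.4 (from the two push-forward facts) and Example 1.7.4
  have h14 : map_mem_ratTrivial (d + e) (k := k) :=
    map_mem_ratTrivial_of_facts map_div_eq_zero_of_dim_eq_add_one_holds map_div_eq_div_norm_holds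
      (d + e)
  have hpush := h14 f' hrat
  have hdeg' := Fulton1998_finiteFlat_map_flatPullback_holds f' hf hrank' c
  change AlgebraicCycle.map p' height height (flatPullback p' hf c) = N • c at hdeg'
  change AlgebraicCycle.map p' height height (flatPullback p' hf c) ∈
    ratTrivial (V : Scheme.{u}) (d + e) at hpush
  rw [hdeg'] at hpush
  rw [map_nsmul]
  exact hpush

end PrincipleSum



/-! ### Cardinality of function fields -/

section Cardinality

/-- **The function field of a variety over an infinite field `C` has the cardinality of `C`**:
it is the fraction field of a quotient of a polynomial ring in finitely many variables over `C`
(the affine argument of `cardinalMk_functionField_le_aleph0`), and contains `C`. [folklore] -/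
theorem cardinalMk_functionField_eq {C : Type u} [Field C] [Infinite C] (Y : SchemeOver C)
    [IsIntegral Y.left] [LocallyOfFiniteType Y.hom] : #Y.left.functionField = #C := by
  obtain ⟨_, ⟨U, hU, rfl⟩, hηU, -⟩ :=
    Y.left.isBasis_affineOpens.exists_subset_of_mem_open (Set.mem_univ (genericPoint Y.left))
      isOpen_univ
  have hU : IsAffineOpen U := hU
  haveI : Nonempty U := ⟨⟨_, hηU⟩⟩
  let ι : C →+* Γ(Spec (CommRingCat.of C), ⊤) := (Scheme.ΓSpecIso (CommRingCat.of C)).inv.hom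
  letI algU : Algebra C Γ(Y.left, U) := ((Y.hom.appLE ⊤ U le_top).hom.comp ι).toAlgebra
  haveI : Algebra.FiniteType C Γ(Y.left, U) := by
    have h1 : (Y.hom.appLE ⊤ U le_top).hom.FiniteType :=
      Y.hom.finiteType_appLE (isAffineOpen_top _) hU le_top
    have h2 : ι.FiniteType :=
      RingHom.FiniteType.of_surjective _
        (Scheme.ΓSpecIso (CommRingCat.of C)).symm.commRingCatIsoToRingEquiv.surjective
    exact h1.comp h2
  haveI : IsFractionRing Γ(Y.left, U) Y.left.functionField :=
    functionField_isFractionRing_of_isAffineOpen Y.left U hU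
  obtain ⟨n, g, hg⟩ :=
    Algebra.FiniteType.iff_quotient_mvPolynomial''.mp ‹Algebra.FiniteType C Γ(Y.left, U)›
  apply le_antisymm
  · have hΓ : #Γ(Y.left, U) ≤ #C := by
      refine (Cardinal.mk_le_of_surjective hg).trans (MvPolynomial.cardinalMk_le_max_lift.trans ?_)
      refine max_le (max_le ?_ ?_) (Cardinal.aleph0_le_mk C)
      · simp
      · exact (Cardinal.natCast_lt_aleph0 (n := n)).le.trans (by simp)
    exact (IsLocalization.cardinalMk_le (nonZeroDivisors Γ(Y.left, U))).trans hΓ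
  · letI : Algebra C Y.left.functionField :=
      ((algebraMap Γ(Y.left, U) Y.left.functionField).comp (algebraMap C Γ(Y.left, U))).toAlgebra
    exact Cardinal.mk_le_of_injective (algebraMap C Y.left.functionField).injective

/-- The algebraic closure of an infinite field has the same cardinality. [folklore] -/
theorem cardinalMk_algebraicClosure_eq {K : Type u} [Field K] [Infinite K] :
    #(AlgebraicClosure K) = #K := by
  apply le_antisymm
  · exact (Algebra.IsAlgebraic.cardinalMk_le_max K (AlgebraicClosure K)).trans
      (max_le le_rfl (Cardinal.aleph0_le_mk K))
  · exact Cardinal.mk_le_of_injective (algebraMap K (AlgebraicClosure K)).injective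

end Cardinality



/-! ### The generic fibre of a cycle over an extension `Ω ⊇ k(T)`, as a combination of fibres of prime families -/

section GenericFibreOverExt

open CartesianMonoidalCategory

variable {k : Type u} [Field k] {X T : SchemeOver k} [LocallyOfFiniteType X.hom]
  [IsIntegral T.left] [LocallyOfFiniteType T.hom]

/-- **The generic fibre of a `(d+e)`-cycle `c` on `X ×ₖ T` over an extension `Ω ⊇ k(T)` is a
`d`-cycle.** Here `T` is integral of finite type and dimension `e`, `η_Ω : Spec Ω → Spec k(T) → T`
(`Resolution.fromSpecExtension`), and the generic fibre over `Ω` of `c = Σ_z c(z)·[closure {z}]` is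
rendered as the combination `Σ_z c(z)·[closure {z} ×_T η_Ω]` of the fibres of the prime families
(`familyFiberOver`, the form consumed by Bloch's limit argument). Proof: `η_Ω` factors through the
residue field of the generic point (`Scheme.descResidueField`), so `X ×ₖ Spec Ω` is the base change
of the scheme-theoretic generic fibre `X_η` along `κ(η) → Ω`; the combination is the flat pull-back
of the restriction `c_{|X_η}` (a `d`-cycle, `genericFibreRestrict_mem_cyclesOfDim`; Fulton's
Lemma 1.7.1 in the forms `algebraicCycleComap_cycle_eq_cycle_preimage`, `flatPullbackFun_cycle`),
and base change of cycles along a field extension preserves the dimension grading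
(`AlgebraicCycle.baseChange_mem_cyclesOfDim_holds`, Fulton Ex. 6.2.9).
[cite: Fulton1998, Lemma 1.7.1 and Example 6.2.9] [cite: BlochLectures2010, Lemma 1A.1] -/
theorem familyFibreSum_mem_cyclesOfDim [IsLocallyNoetherian (X ⊗ T).left]
    (hZ : locallyFinsupp_fundamentalCycleFun.{u})
    {d e : ℕ} (he : height (genericPoint T.left) = e)
    {c : AlgebraicCycle (X ⊗ T).left ℤ} (hc : c ∈ cyclesOfDim (X ⊗ T).left (d + e))
    (s : Finset ↥(X ⊗ T).left) (hs : ∀ z, c z ≠ 0 → z ∈ s)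
    {Ω : Type u} [Field Ω] [Algebra T.left.functionField Ω] :
    (∑ z ∈ s, c z • (familyFiberOver (ClosedSubvariety.ofPoint (X ⊗ T).left z).toClosedSubscheme
        (Resolution.fromSpecExtension T.left Ω)).cycle hZ) ∈
      cyclesOfDim (X ⊗ ptOver T (Resolution.fromSpecExtension T.left Ω)).left d := by
  -- notation
  set η := genericPoint T.left with hη
  set ηΩ := Resolution.fromSpecExtension T.left Ω with hηΩ
  let PΩ : SchemeOver k := ptOver T ηΩ
  let pP : (X ⊗ PΩ).left ⟶ (X ⊗ T).left := (X ◁ ptOverι T ηΩ).left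
  let sP : (X ⊗ PΩ).left ⟶ Spec (.of Ω) := (snd X PΩ).left
  have big : IsPullback pP sP (snd X T).left ηΩ := isPullback_whiskerLeft X (ptOverι T ηΩ)
  -- `η_Ω` factors through the residue field of `η`
  let fΩ : T.left.presheaf.stalk η ⟶ .of Ω := CommRingCat.ofHom (algebraMap T.left.functionField Ω)
  haveI : IsLocalHom fΩ.hom := by
    refine ⟨fun a ha ↦ ?_⟩
    rcases eq_or_ne a 0 with rfl | h
    · rw [map_zero] at ha
      exact (not_isUnit_zero (M₀ := Ω) ha).elim
    · exact isUnit_iff_ne_zero.mpr h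
  let φ : T.left.residueField η ⟶ .of Ω := T.left.descResidueField fΩ
  have hφ : Spec.map φ ≫ T.left.fromSpecResidueField η = ηΩ :=
    Scheme.descResidueField_fromSpecResidueField T.left fΩ
  -- the scheme-theoretic generic fibre `F = X_η` and `r' : X ×ₖ Spec Ω → F`
  let Fι := (snd X T).left.fiberι η
  let Fs := (snd X T).left.fiberToSpecResidueField η
  haveI : LocallyOfFiniteType (snd X T).left :=
    inferInstanceAs (LocallyOfFiniteType (pullback.snd X.hom T.hom))
  haveI : LocallyOfFiniteType Fs := MorphismProperty.pullback_snd _ _ inferInstance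
  haveI : IsLocallyNoetherian ((snd X T).left.fiber η) := LocallyOfFiniteType.isLocallyNoetherian Fs
  haveI : Flat (T.left.fromSpecResidueField η) :=
    Literature.AlgebraicGeometry.Morphisms.flat_fromSpecResidueField_genericPoint T.left
  haveI : Flat Fι := MorphismProperty.pullback_fst _ _ inferInstance
  have hw : pP ≫ (snd X T).left = (sP ≫ Spec.map φ) ≫ T.left.fromSpecResidueField η := by
    rw [Category.assoc, hφ]; exact big.w
  let r' : (X ⊗ PΩ).left ⟶ (snd X T).left.fiber η := pullback.lift pP (sP ≫ Spec.map φ) hw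
  have hr'₁ : r' ≫ Fι = pP := pullback.lift_fst _ _ _
  have hr'₂ : r' ≫ Fs = sP ≫ Spec.map φ := pullback.lift_snd _ _ _
  have big' : IsPullback (r' ≫ Fι) sP (snd X T).left (Spec.map φ ≫ T.left.fromSpecResidueField η) := by
    rw [hr'₁, hφ]; exact big
  have sq : IsPullback r' sP Fs (Spec.map φ) :=
    IsPullback.of_right big' hr'₂ (IsPullback.of_hasPullback _ _)
  -- `X ×ₖ Spec Ω` as the base change of the `κ(η)`-scheme `F` along `φ`
  let F' : SchemeOver (T.left.residueField η) := Over.mk Fs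
  haveI : LocallyOfFiniteType F'.hom := inferInstanceAs (LocallyOfFiniteType Fs)
  have sq' : IsPullback r' sP F'.hom (Spec.map (CommRingCat.ofHom φ.hom)) := sq
  let eB : (X ⊗ PΩ).left ≅ ((baseChangeHom φ.hom).obj F').left := sq'.isoPullback
  have heB : eB.hom ≫ baseChangeHomFst φ.hom F' = r' := sq'.isoPullback_hom_fst
  haveI : Flat (Spec.map φ) := by
    rw [HasRingHomProperty.Spec_iff (P := @Flat)]
    letI := φ.hom.toAlgebra
    change Module.Flat (T.left.residueField η) Ω
    infer_instance
  haveI : Flat r' := MorphismProperty.of_isPullback sq.flip inferInstance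
  -- the restriction of `c` to `F` is a `d`-cycle
  have hζK : genericFibreRestrict X T c ∈ cyclesOfDim ((snd X T).left.fiber η) d :=
    genericFibreRestrict_mem_cyclesOfDim X T he hc
  have hπ : locallyFinsupp_flatPullbackFun_baseChangeHomFst.{u} :=
    locallyFinsupp_flatPullbackFun_baseChangeHomFst_holds
  have hBC : AlgebraicCycle.baseChange φ.hom F' hπ (genericFibreRestrict X T c) ∈
      cyclesOfDim ((baseChangeHom φ.hom).obj F').left d :=
    AlgebraicCycle.baseChange_mem_cyclesOfDim_holds φ.hom F' hπ hζK
  -- the combination of fibres is `r'^*(c_{|F})`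
  have hone : ∀ z : ↥(X ⊗ T).left,
      ⇑((familyFiberOver (ClosedSubvariety.ofPoint (X ⊗ T).left z).toClosedSubscheme ηΩ).cycle hZ) =
        r'.flatPullbackFun (genericFibreRestrict X T (primeCycle z)) := by
    intro z
    set W := (ClosedSubvariety.ofPoint (X ⊗ T).left z).toClosedSubscheme with hW
    have hWc : W.cycle hZ = primeCycle z := by
      rw [show W.cycle hZ = primeCycle (ClosedSubvariety.ofPoint (X ⊗ T).left z).genericPoint from
        ClosedSubvariety.cycle_toClosedSubscheme_holds _ hZ, ClosedSubvariety.genericPoint_ofPoint]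
    have h1 : genericFibreRestrict X T (primeCycle z) = (W.preimage Fι).cycle hZ := by
      rw [← hWc]
      exact algebraicCycleComap_cycle_eq_cycle_preimage Fι hZ W
    rw [h1, flatPullbackFun_cycle r' hZ]
    congr 1
    change (W.preimage pP).cycle hZ = ((W.preimage Fι).preimage r').cycle hZ
    symm
    refine ClosedSubscheme.cycle_eq_of_iso _ _
      (pullbackLeftPullbackSndIso W.ι Fι r' ≪≫ pullback.congrHom rfl hr'₁) ?_ hZ
    change (_ ≫ _) ≫ pullback.snd _ _ = pullback.snd (pullback.snd W.ι Fι) r'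
    rw [Category.assoc, pullback.congrHom_hom, pullback.lift_snd, Category.comp_id]
    exact pullbackLeftPullbackSndIso_hom_snd _ _ _
  have hsum : ⇑(∑ z ∈ s, c z • (familyFiberOver
      (ClosedSubvariety.ofPoint (X ⊗ T).left z).toClosedSubscheme ηΩ).cycle hZ) =
      r'.flatPullbackFun (genericFibreRestrict X T c) := by
    conv_rhs => rw [eq_sum_smul_primeCycle c hs]
    rw [map_sum, Function.locallyFinsuppWithin.coe_sum,
      show r'.flatPullbackFun (∑ z ∈ s, genericFibreRestrict X T (c z • primeCycle z)) =
        ∑ z ∈ s, r'.flatPullbackFun (genericFibreRestrict X T (c z • primeCycle z)) from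
        map_sum (AddMonoidHom.mk' r'.flatPullbackFun (flatPullbackFun_add r')) _ s]
    refine Finset.sum_congr rfl fun z _ ↦ ?_
    rw [map_zsmul, Function.locallyFinsuppWithin.coe_zsmul, hone z,
      show r'.flatPullbackFun (c z • genericFibreRestrict X T (primeCycle z)) =
        c z • r'.flatPullbackFun (genericFibreRestrict X T (primeCycle z)) from
        map_zsmul (AddMonoidHom.mk' r'.flatPullbackFun (flatPullbackFun_add r')) _ _]
  -- compare with the base change along `eB`
  intro y hy
  have hy' : r'.flatPullbackFun (genericFibreRestrict X T c) y ≠ 0 := by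
    rw [← hsum]; exact hy
  have hval : AlgebraicCycle.baseChange φ.hom F' hπ (genericFibreRestrict X T c) (eB.hom.base y) =
      r'.flatPullbackFun (genericFibreRestrict X T c) y := by
    change (baseChangeHomFst φ.hom F').flatPullbackFun (genericFibreRestrict X T c) (eB.hom.base y) = _
    rw [flatPullbackFun_def, flatPullbackFun_def]
    have e1 : (baseChangeHomFst φ.hom F').base (eB.hom.base y) = r'.base y := by
      have h := congrArg (fun f : (X ⊗ PΩ).left ⟶ _ ↦ f.base y) heB
      exact h
    have h2 := stalkLength_fiber_comp eB.hom (baseChangeHomFst φ.hom F') y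
    rw [stalkLength_fiber_asFiber_of_isOpenImmersion eB.hom y, mul_one] at h2
    have h3 := stalkLength_fiber_congr heB y
    simp only [fundamentalCycleFun_apply]
    exact congrArg₂ (· * ·) (congrArg (⇑(genericFibreRestrict X T c)) e1)
      (congrArg (Nat.cast : ℕ → ℤ) (h2.symm.trans h3))
  have hBy := hBC (eB.hom.base y) (by rw [hval]; exact hy')
  have hh : height (eB.hom.base y) = height y := height_eq_of_homeomorph (Scheme.homeoOfIso eB) y
  rwa [hh] at hBy

end GenericFibreOverExt

/-! ### The rank-one hypothesis on the generic fibre of a cycle over `T`, in the family presentation -/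

section RankOneFamilyFibre

open CartesianMonoidalCategory

variable {C : Type} [Field C] [IsAlgClosed C] [CharZero C]

/-- **`M • c_{|X_{η_Ω}} ∼ w_Ω` for a `(k+e)`-cycle `c` on `X × T`.** For `X` projective over an
uncountable algebraically closed `C` of characteristic `0` with `k`-cycles of rank `≤ 1`, `T` an
integral `C`-scheme of finite type and dimension `e`, `Ω` an algebraic closure of `C(T)` and
`η_Ω : Spec Ω → T` the generic point: the generic fibre `Σ_z c(z)·[closure {z} ×_T η_Ω]` of `c` over
`Ω` satisfies `M • (–) − E_w ∈ Rat_k(X ×_C Spec Ω)` for some `M ≠ 0`, a `k`-cycle `w` on `X` and a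
cycle `E_w` supported over the support of `w` (namely `w_Ω`). This is
`exists_zsmul_sub_baseChange_mem_ratTrivial` (Vial's isomorphism) transported along the
identification `X ×_C Spec Ω = X_{Ω,j}` for the homomorphism `j : C → Ω` underlying
`Spec Ω → T → Spec C` (`Spec.preimage`), the grading being `familyFibreSum_mem_cyclesOfDim`; it is the
replacement, on the tree's carriers, of "`M Z̃'_* = 0` on `CH₀(T̃)_hom`", `W_i = Z̃'_*(t_i)` in the
proof of Voisin II, Thm. 10.29. [cite: VoisinHodgeII2003, Thm. 10.29 (proof)]
[cite: Vial2013, Lemma 2.1] [cite: Fulton1998, Example 6.2.9] -/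
theorem exists_zsmul_familyFibreSum_sub_mem_ratTrivial (hC : ℵ₀ < #C) (X : SchemeOver C)
    [IsIntegral X.left] [LocallyOfFiniteType X.hom] [QuasiCompact X.hom] (hX : IsProjectiveOver X)
    {T : SchemeOver C} [IsIntegral T.left] [LocallyOfFiniteType T.hom]
    [IsLocallyNoetherian (X ⊗ T).left]
    {k e : ℕ} (he : height (genericPoint T.left) = e)
    (hH : ∀ c ∈ cyclesOfDim X.left k, ∀ c' ∈ cyclesOfDim X.left k,
      ∃ a b : ℤ, (a ≠ 0 ∨ b ≠ 0) ∧ IsRationallyEquivalent (a • c) (b • c') k)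
    (hZ : locallyFinsupp_fundamentalCycleFun.{0})
    {c : AlgebraicCycle (X ⊗ T).left ℤ} (hc : c ∈ cyclesOfDim (X ⊗ T).left (k + e))
    (s : Finset ↥(X ⊗ T).left) (hs : ∀ z, c z ≠ 0 → z ∈ s) :
    ∃ M : ℤ, M ≠ 0 ∧ ∃ w ∈ cyclesOfDim X.left k,
      ∃ Ew : AlgebraicCycle (X ⊗ ptOver T (Resolution.fromSpecExtension T.left
          (AlgebraicClosure T.left.functionField))).left ℤ,
        (∀ y, Ew y ≠ 0 → w ((fst X (ptOver T (Resolution.fromSpecExtension T.left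
          (AlgebraicClosure T.left.functionField)))).left.base y) ≠ 0) ∧
        M • (∑ z ∈ s, c z • (familyFiberOver (ClosedSubvariety.ofPoint (X ⊗ T).left z).toClosedSubscheme
            (Resolution.fromSpecExtension T.left (AlgebraicClosure T.left.functionField))).cycle hZ) - Ew ∈
          ratTrivial (X ⊗ ptOver T (Resolution.fromSpecExtension T.left
            (AlgebraicClosure T.left.functionField))).left k := by
  set Ω := AlgebraicClosure T.left.functionField with hΩdef
  have hΩ : #Ω = #C := by
    haveI : Infinite T.left.functionField :=
      Cardinal.infinite_iff.mpr (hC.le.trans (cardinalMk_functionField_eq T).ge)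
    exact cardinalMk_algebraicClosure_eq.trans (cardinalMk_functionField_eq T)
  set ηΩ := Resolution.fromSpecExtension T.left Ω with hηΩ
  let PΩ : SchemeOver C := ptOver T ηΩ
  -- the homomorphism `j : C → Ω` underlying `Spec Ω → T → Spec C`
  let jΩ' : CommRingCat.of C ⟶ CommRingCat.of Ω := Spec.preimage (ηΩ ≫ T.hom)
  let jΩ : C →+* Ω := jΩ'.hom
  have hj : ηΩ ≫ T.hom = Spec.map (CommRingCat.ofHom jΩ) := by
    change ηΩ ≫ T.hom = Spec.map (CommRingCat.ofHom jΩ'.hom)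
    rw [CommRingCat.ofHom_hom, Spec.map_preimage]
  have hπ : locallyFinsupp_flatPullbackFun_baseChangeHomFst.{0} :=
    locallyFinsupp_flatPullbackFun_baseChangeHomFst_holds
  let Xb : SchemeOver Ω := (baseChangeHom jΩ).obj X
  haveI : LocallyOfFiniteType Xb.hom :=
    inferInstanceAs (LocallyOfFiniteType (pullback.snd X.hom (Spec.map (CommRingCat.ofHom jΩ))))
  let XPΩ : SchemeOver Ω := Over.mk (snd X PΩ).left
  haveI : LocallyOfFiniteType XPΩ.hom := inferInstanceAs (LocallyOfFiniteType (pullback.snd X.hom PΩ.hom))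
  -- `X × Spec Ω = X_{Ω,j}`
  let eP : (X ⊗ PΩ).left ≅ Xb.left := pullback.congrHom rfl hj
  have heP₁ : eP.hom ≫ baseChangeHomFst jΩ X = (fst X PΩ).left := by
    change (pullback.congrHom rfl hj).hom ≫ pullback.fst _ _ = pullback.fst _ _
    rw [pullback.congrHom_hom, pullback.lift_fst, Category.comp_id]
  have heP₂ : eP.inv ≫ (snd X PΩ).left = Xb.hom := by
    change (pullback.congrHom rfl hj).inv ≫ pullback.snd _ _ = pullback.snd _ _
    rw [pullback.congrHom_inv, pullback.lift_snd, Category.comp_id]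
  -- the generic fibre is a `k`-cycle, transport it to `X_{Ω,j}` and apply the rank-one transport
  have hζP := familyFibreSum_mem_cyclesOfDim (X := X) (T := T) hZ he hc s hs (Ω := Ω)
  set ζP := ∑ z ∈ s, c z • (familyFiberOver (ClosedSubvariety.ofPoint (X ⊗ T).left z).toClosedSubscheme
    ηΩ).cycle hZ with hζPdef
  have hζ : AlgebraicCycle.map eP.hom height height ζP ∈ cyclesOfDim Xb.left k :=
    (algebraicCycleMap_hom_mem_cyclesOfDim_iff eP ζP).mpr hζP
  obtain ⟨M, hM, w, hw, hrel⟩ := exists_zsmul_sub_baseChange_mem_ratTrivial hC X hX hH jΩ hΩ hπ hζ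
  -- transport back along `eP`
  let Mi : AlgebraicCycle Xb.left ℤ →+ AlgebraicCycle (X ⊗ PΩ).left ℤ :=
    AddMonoidHom.mk' (AlgebraicCycle.map eP.inv height height) (algebraicCycleMap_add eP.inv _ _)
  have hMi : ∀ x, Mi x = AlgebraicCycle.map eP.inv height height x := fun _ ↦ rfl
  have htr : Mi (M • AlgebraicCycle.map eP.hom height height ζP - AlgebraicCycle.baseChange jΩ X hπ w) ∈
      ratTrivial (X ⊗ PΩ).left k :=
    algebraicCycleMap_hom_mem_ratTrivial Xb XPΩ eP.symm heP₂ hrel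
  rw [map_sub, map_zsmul, hMi, hMi, algebraicCycleMap_inv_map_hom] at htr
  refine ⟨M, hM, w, hw, AlgebraicCycle.map eP.inv height height (AlgebraicCycle.baseChange jΩ X hπ w),
    fun y hy ↦ ?_, htr⟩
  -- the support of `w_Ω` lies over the support of `w`
  have h1 : AlgebraicCycle.map eP.inv height height (AlgebraicCycle.baseChange jΩ X hπ w) y =
      AlgebraicCycle.baseChange jΩ X hπ w (eP.hom.base y) := by
    have h := algebraicCycleMap_hom_apply' eP.symm (AlgebraicCycle.baseChange jΩ X hπ w) y
    simpa only [Iso.symm_hom, Iso.symm_inv] using h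
  rw [h1, AlgebraicCycle.baseChange_apply] at hy
  have h2 := support_flatPullbackFun_subset _ _ hy
  rw [Set.mem_preimage, Function.mem_support] at h2
  have h3 : (baseChangeHomFst jΩ X).base (eP.hom.base y) = (fst X PΩ).left.base y := by
    rw [← Scheme.Hom.comp_apply, heP₁]
  rwa [h3] at h2

end RankOneFamilyFibre

/-! ### From the generic fibre to a dense open: the principle for a cycle over `T`, off a closed set of dimension `≤ k` -/

section PrincipleForCycle

open CartesianMonoidalCategory OpenGraph Literature.AlgebraicGeometry.Limits

variable {C : Type} [Field C] [IsAlgClosed C] [CharZero C]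

/-- **`N • c` is rationally trivial on `(X ∖ S) × U` for a closed `S ⊆ X` of dimension `≤ k` and a
dense open `U ⊆ T`.** For `X` projective over an uncountable algebraically closed `C` of
characteristic `0` with `k`-cycles of rank `≤ 1`, `T` an integral `C`-scheme of finite type and
dimension `e`, and a `(k+e)`-cycle `c` on `X × T`: there are `N > 0`, a closed `S ⊆ X` all of whose
points have dimension `≤ k`, and a non-empty open `U ⊆ T` such that the restriction of `N • c` to
the open `(X ∖ S) × U ⊆ X × T` lies in `Rat_{k+e}`. Proof: `M • c_{|X_{η_Ω}} ∼ w_Ω`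
(`exists_zsmul_familyFibreSum_sub_mem_ratTrivial`); with `S = ⋃_{p ∈ supp w} closure {p}` the
restriction to `(X ∖ S) ×_C Spec Ω` kills `w_Ω` (Fulton, Thm. 1.7 for the open immersion), so the
generic fibre of `M • c_{|(X∖S)×T}` is rationally trivial over the algebraic extension `Ω ⊇ C(T)`,
and the Bloch–Srinivas principle for sums over the integral base `T` (`principle_sum_of_algExt`)
gives `N' M • c` rationally trivial on `(X ∖ S) × U`. This is Thm. 10.19 of Voisin II as used in
the proof of Thm. 10.29 ("We then apply theorem 10.19 to conclude that there exists a cycle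
`Z̃'' ⊂ T̃' × X` […] and an integer `M'` such that `M'M(Z̃' − Σᵢ T̃ᵢ × Wᵢ) = Z̃''`"), over a dense
open of `T` instead of a desingularisation. [cite: VoisinHodgeII2003, Thm. 10.19 and Thm. 10.29 (proof)]
[cite: Voisin2019BirationalDiagonal, Thm. 2.3] [cite: Fulton1998, Theorem 1.7] -/
theorem exists_open_nsmul_restrict_mem_ratTrivial (hC : ℵ₀ < #C) (X : SchemeOver C)
    [IsIntegral X.left] [LocallyOfFiniteType X.hom] [QuasiCompact X.hom] [CompactSpace ↥X.left]
    (hX : IsProjectiveOver X)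
    {T : SchemeOver C} [IsIntegral T.left] [LocallyOfFiniteType T.hom] [QuasiCompact T.hom]
    {k e : ℕ} (he : height (genericPoint T.left) = e)
    (hH : ∀ c ∈ cyclesOfDim X.left k, ∀ c' ∈ cyclesOfDim X.left k,
      ∃ a b : ℤ, (a ≠ 0 ∨ b ≠ 0) ∧ IsRationallyEquivalent (a • c) (b • c') k)
    (hf : locallyFinsupp_flatPullbackFun.{0})
    {c : AlgebraicCycle (X ⊗ T).left ℤ} (hc : c ∈ cyclesOfDim (X ⊗ T).left (k + e)) :
    ∃ N : ℕ, 0 < N ∧ ∃ S : Set X.left, IsClosed S ∧ (∀ p ∈ S, height p ≤ k) ∧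
      ∃ U : T.left.Opens, (U : Set T.left).Nonempty ∧ ∀ hS : IsOpen Sᶜ,
        flatPullback ((fst X T).left ⁻¹ᵁ ⟨Sᶜ, hS⟩ ⊓ (snd X T).left ⁻¹ᵁ U).ι hf (N • c) ∈
          ratTrivial (↑((fst X T).left ⁻¹ᵁ ⟨Sᶜ, hS⟩ ⊓ (snd X T).left ⁻¹ᵁ U) : Scheme.{0}) (k + e) := by
  classical
  haveI : LocallyOfFiniteType (X ⊗ T).hom :=
    inferInstanceAs (LocallyOfFiniteType (pullback.fst X.hom T.hom ≫ X.hom))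
  haveI : QuasiCompact (X ⊗ T).hom := inferInstanceAs (QuasiCompact (pullback.fst X.hom T.hom ≫ X.hom))
  haveI : IsLocallyNoetherian (X ⊗ T).left := LocallyOfFiniteType.isLocallyNoetherian (X ⊗ T).hom
  haveI : IsLocallyNoetherian X.left := LocallyOfFiniteType.isLocallyNoetherian X.hom
  have hZ : locallyFinsupp_fundamentalCycleFun.{0} := locallyFinsupp_fundamentalCycleFun_holds
  -- the support of `c`
  haveI : QuasiCompact (snd X T).left := inferInstanceAs (QuasiCompact (pullback.snd X.hom T.hom))
  haveI : CompactSpace ↥T.left := QuasiCompact.compactSpace_of_compactSpace T.hom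
  haveI : CompactSpace ↥(X ⊗ T).left := QuasiCompact.compactSpace_of_compactSpace (snd X T).left
  have hfin : (Function.support c).Finite := by
    have h := c.locallyFiniteSupport.finite_inter_support_of_isCompact isCompact_univ
    rwa [Set.univ_inter] at h
  set s : Finset ↥(X ⊗ T).left := hfin.toFinset with hsdef
  have hs : ∀ z, c z ≠ 0 → z ∈ s := fun z hz ↦ by
    rw [hsdef, Set.Finite.mem_toFinset, Function.mem_support]
    exact hz
  -- `M • c_{|X_{η_Ω}} ∼ w_Ω`
  obtain ⟨M, hM, w, hw, Ew, hEw, hrel⟩ :=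
    exists_zsmul_familyFibreSum_sub_mem_ratTrivial hC X hX he hH hZ hc s hs
  -- the closed set `S = ⋃ closure {p}`, `p ∈ supp w`, and `O = X ∖ S`
  have hwfin : (Function.support w).Finite := by
    have h := w.locallyFiniteSupport.finite_inter_support_of_isCompact isCompact_univ
    rwa [Set.univ_inter] at h
  set Sw : Finset X.left := hwfin.toFinset with hSwdef
  set S : Set X.left := ⋃ p ∈ Sw, closure {p} with hSdef
  have hSc : IsClosed S := Sw.finite_toSet.isClosed_biUnion fun _ _ ↦ isClosed_closure
  have hSdim : ∀ p ∈ S, height p ≤ k := by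
    intro p hp
    rw [hSdef] at hp
    obtain ⟨q, hq, hpq⟩ := Set.mem_iUnion₂.mp hp
    have hq' : w q ≠ 0 := by
      rw [hSwdef, Set.Finite.mem_toFinset, Function.mem_support] at hq
      exact hq
    have hle : p ≤ q := Scheme.le_iff_specializes.mpr (specializes_iff_mem_closure.mpr hpq)
    calc height p ≤ height q := Order.height_mono hle
      _ = k := hw q hq'
  have hwS : ∀ p, w p ≠ 0 → p ∈ S := fun p hp ↦
    Set.mem_biUnion (show p ∈ (Sw : Set X.left) by
      rw [Finset.mem_coe, hSwdef, Set.Finite.mem_toFinset, Function.mem_support]; exact hp)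
      (subset_closure rfl)
  set O : X.left.Opens := ⟨Sᶜ, hSc.isOpen_compl⟩ with hOdef
  by_cases hOe : ((O : Set X.left)).Nonempty
  swap
  · -- `O = ∅`: the open `(X ∖ S) × U` is empty
    refine ⟨1, one_pos, S, hSc, hSdim, ⊤, ⟨genericPoint T.left, trivial⟩, fun hS' ↦ ?_⟩
    have hV : ∀ v : ↥((fst X T).left ⁻¹ᵁ ⟨Sᶜ, hS'⟩ ⊓ (snd X T).left ⁻¹ᵁ (⊤ : T.left.Opens)),
        False := fun v ↦ hOe ⟨(fst X T).left.base v.1, v.2.1⟩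
    convert AddSubgroup.zero_mem _
    ext v
    exact (hV v).elim
  -- `O ≠ ∅`: the open subscheme `X' = X ∖ S` as a `C`-variety
  haveI : IsNoetherian X.left := {}
  haveI : Nonempty ↥(O : Scheme.{0}) := by
    obtain ⟨x, hx⟩ := hOe
    exact ⟨⟨x, hx⟩⟩
  haveI : IsIntegral (O : Scheme.{0}) := isIntegral_of_isOpenImmersion O.ι
  let X' : SchemeOver C := openOver X O
  haveI : LocallyOfFiniteType X'.hom := inferInstanceAs (LocallyOfFiniteType (O.ι ≫ X.hom))
  haveI : QuasiCompact X'.hom := inferInstanceAs (QuasiCompact (O.ι ≫ X.hom))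
  haveI : IsIntegral X'.left := ‹IsIntegral (O : Scheme.{0})›
  haveI : LocallyOfFiniteType (X' ⊗ T).hom :=
    inferInstanceAs (LocallyOfFiniteType (pullback.fst X'.hom T.hom ≫ X'.hom))
  haveI : QuasiCompact (X' ⊗ T).hom :=
    inferInstanceAs (QuasiCompact (pullback.fst X'.hom T.hom ≫ X'.hom))
  haveI : IsLocallyNoetherian (X' ⊗ T).left := LocallyOfFiniteType.isLocallyNoetherian (X' ⊗ T).hom
  haveI : CompactSpace ↥(X' ⊗ T).left := QuasiCompact.compactSpace_of_compactSpace (X' ⊗ T).hom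
  haveI : IsNoetherian (X' ⊗ T).left := {}
  -- `jO : X' × T → X × T`, an open immersion, base change of `O ↪ X`
  set ι' : X' ⟶ X := openOverι X O with hι'
  set jO : (X' ⊗ T).left ⟶ (X ⊗ T).left := (ι' ▷ T).left with hjO
  have hjOfst : jO ≫ (fst X T).left = (fst X' T).left ≫ O.ι := Over.whiskerRight_left_fst ι'
  have hjOsnd : jO ≫ (snd X T).left = (snd X' T).left := Over.whiskerRight_left_snd ι'
  have HjO : IsPullback jO (fst X' T).left (fst X T).left O.ι := by
    refine IsPullback.of_right ?_ hjOfst (IsPullback.of_hasPullback X.hom T.hom).flip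
    have h1 : jO ≫ pullback.snd X.hom T.hom = pullback.snd X'.hom T.hom := hjOsnd
    rw [h1]
    exact (IsPullback.of_hasPullback X'.hom T.hom).flip
  haveI : IsOpenImmersion jO :=
    MorphismProperty.of_isPullback HjO.flip (inferInstance : IsOpenImmersion O.ι)
  -- the same over `Spec Ω`
  let Ω := AlgebraicClosure T.left.functionField
  let ηΩ := Resolution.fromSpecExtension T.left Ω
  let PΩ : SchemeOver C := ptOver T ηΩ
  let g : PΩ ⟶ T := ptOverι T ηΩ
  let J : (X' ⊗ PΩ).left ⟶ (X ⊗ PΩ).left := (ι' ▷ PΩ).left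
  have hJfst : J ≫ (fst X PΩ).left = (fst X' PΩ).left ≫ O.ι := Over.whiskerRight_left_fst ι'
  have hJsnd : J ≫ (snd X PΩ).left = (snd X' PΩ).left := Over.whiskerRight_left_snd ι'
  have HJ : IsPullback J (fst X' PΩ).left (fst X PΩ).left O.ι := by
    refine IsPullback.of_right ?_ hJfst (IsPullback.of_hasPullback X.hom PΩ.hom).flip
    have h1 : J ≫ pullback.snd X.hom PΩ.hom = pullback.snd X'.hom PΩ.hom := hJsnd
    rw [h1]
    exact (IsPullback.of_hasPullback X'.hom PΩ.hom).flip
  haveI : IsOpenImmersion J :=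
    MorphismProperty.of_isPullback HJ.flip (inferInstance : IsOpenImmersion O.ι)
  have hsq : J ≫ (X ◁ g).left = (X' ◁ g).left ≫ jO := by
    change (ι' ▷ PΩ).left ≫ (X ◁ g).left = (X' ◁ g).left ≫ (ι' ▷ T).left
    rw [← Over.comp_left, ← Over.comp_left, MonoidalCategory.whisker_exchange]
  -- `X × Spec Ω`, `X' × Spec Ω` as `Ω`-schemes of finite type
  let XPΩ : SchemeOver Ω := Over.mk (snd X PΩ).left
  let XPΩ' : SchemeOver Ω := Over.mk (snd X' PΩ).left
  let J' : XPΩ' ⟶ XPΩ := Over.homMk J hJsnd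
  haveI : LocallyOfFiniteType XPΩ.hom := inferInstanceAs (LocallyOfFiniteType (pullback.snd X.hom PΩ.hom))
  haveI : QuasiCompact XPΩ.hom := inferInstanceAs (QuasiCompact (pullback.snd X.hom PΩ.hom))
  haveI : LocallyOfFiniteType XPΩ'.hom :=
    inferInstanceAs (LocallyOfFiniteType (pullback.snd X'.hom PΩ.hom))
  haveI : QuasiCompact XPΩ'.hom := inferInstanceAs (QuasiCompact (pullback.snd X'.hom PΩ.hom))
  haveI : QuasiCompact (snd X' PΩ).left := inferInstanceAs (QuasiCompact (pullback.snd X'.hom PΩ.hom))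
  haveI : CompactSpace ↥PΩ.left := inferInstanceAs (CompactSpace ↥(Spec (CommRingCat.of Ω)))
  haveI : CompactSpace ↥(X' ⊗ PΩ).left := QuasiCompact.compactSpace_of_compactSpace (snd X' PΩ).left
  haveI : IsNoetherian (X' ⊗ PΩ).left := {}
  haveI : Flat J'.left := inferInstanceAs (Flat J)
  haveI : LocallyOfFiniteType J'.left := inferInstanceAs (LocallyOfFiniteType J)
  haveI : QuasiCompact J'.left := inferInstanceAs (QuasiCompact J)
  -- the families `[closure {z}]` and their restrictions to `X' × T`
  let 𝒲 : ↥(X ⊗ T).left → ClosedSubscheme (X ⊗ T).left := fun z ↦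
    (ClosedSubvariety.ofPoint (X ⊗ T).left z).toClosedSubscheme
  let 𝒲O : ↥(X ⊗ T).left → ClosedSubscheme (X' ⊗ T).left := fun z ↦ (𝒲 z).preimage jO
  have hWc : ∀ z, (𝒲 z).cycle hZ = primeCycle z := fun z ↦ by
    rw [show (𝒲 z).cycle hZ = primeCycle (ClosedSubvariety.ofPoint (X ⊗ T).left z).genericPoint from
      ClosedSubvariety.cycle_toClosedSubscheme_holds _ hZ, ClosedSubvariety.genericPoint_ofPoint]
  -- (b) restriction of the fibres: `J^*[𝒲_z ×_T η_Ω] = [𝒲O_z ×_T η_Ω]`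
  have hb : ∀ z, flatPullback J hf ((familyFiberOver (𝒲 z) ηΩ).cycle hZ) =
      (familyFiberOver (𝒲O z) ηΩ).cycle hZ := by
    intro z
    rw [flatPullback_cycle_eq_cycle_preimage_holds J hf hZ]
    change (((𝒲 z).preimage (X ◁ g).left).preimage J).cycle hZ =
      (((𝒲 z).preimage jO).preimage (X' ◁ g).left).cycle hZ
    have hA : (((𝒲 z).preimage (X ◁ g).left).preimage J).cycle hZ =
        ((𝒲 z).preimage (J ≫ (X ◁ g).left)).cycle hZ :=
      ClosedSubscheme.cycle_eq_of_iso _ _ (pullbackLeftPullbackSndIso (𝒲 z).ι (X ◁ g).left J)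
        (pullbackLeftPullbackSndIso_hom_snd _ _ _) hZ
    have hB : (((𝒲 z).preimage jO).preimage (X' ◁ g).left).cycle hZ =
        ((𝒲 z).preimage ((X' ◁ g).left ≫ jO)).cycle hZ :=
      ClosedSubscheme.cycle_eq_of_iso _ _ (pullbackLeftPullbackSndIso (𝒲 z).ι jO (X' ◁ g).left)
        (pullbackLeftPullbackSndIso_hom_snd _ _ _) hZ
    rw [hA, hB, hsq]
  -- (a) the restriction kills `w_Ω`
  have ha : flatPullback J hf Ew = 0 := by
    ext y
    rw [flatPullback_apply_of_isOpenImmersion, Function.locallyFinsuppWithin.coe_zero, Pi.zero_apply]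
    by_contra hy
    have h1 := hEw _ hy
    have e1 : (fst X PΩ).left.base (J.base y) = O.ι.base ((fst X' PΩ).left.base y) := by
      rw [← Scheme.Hom.comp_apply J, hJfst]
      exact rfl
    rw [e1] at h1
    have hmem : O.ι.base ((fst X' PΩ).left.base y) ∈ (O : Set X.left) := by
      rw [← Scheme.Opens.range_ι]
      exact ⟨_, rfl⟩
    exact hmem (hwS _ h1)
  -- the generic fibre of `M • c` restricted to `X' × T` is rationally trivial over `Ω`
  have hrelO := flatPullback_mem_ratTrivial_of_finiteType_holds J' hf
    (isEquidimensional_zero_of_isOpenImmersion J) hrel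
  change flatPullback J hf (M • (∑ z ∈ s, c z • (familyFiberOver (𝒲 z) ηΩ).cycle hZ) - Ew) ∈
    ratTrivial (X' ⊗ PΩ).left (k + 0) at hrelO
  have hΩ' : (∑ z ∈ s, (M * c z) • (familyFiberOver (𝒲O z) ηΩ).cycle hZ) ∈
      ratTrivial (X' ⊗ PΩ).left k := by
    rw [map_sub, ha, sub_zero, map_zsmul, map_sum, Finset.smul_sum, Nat.add_zero] at hrelO
    convert hrelO using 1
    refine Finset.sum_congr rfl fun z _ ↦ ?_
    rw [map_zsmul, hb z, smul_smul]
  -- the Bloch–Srinivas principle for the sum over `T`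
  obtain ⟨N, hN, U, hU, hratU⟩ :=
    principle_sum_of_algExt (X := X') (T := T) he s (fun z ↦ M * c z) 𝒲O hZ hf k hΩ'
  -- `Σ (M c(z)) [𝒲O_z] = jO^*(M • c)`
  have hsumO : (∑ z ∈ s, (M * c z) • (𝒲O z).cycle hZ) = flatPullback jO hf (M • c) := by
    conv_rhs => rw [eq_sum_smul_primeCycle c hs]
    rw [Finset.smul_sum, map_sum]
    refine Finset.sum_congr rfl fun z _ ↦ ?_
    rw [smul_smul, map_zsmul, ← hWc z, flatPullback_cycle_eq_cycle_preimage_holds jO hf hZ (𝒲 z)]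
  rw [hsumO, ← map_nsmul] at hratU
  -- transport from the open `X' × U ⊆ X' × T` to the open `(X ∖ S) × U ⊆ X × T`
  refine ⟨N * M.natAbs, Nat.mul_pos hN (Int.natAbs_pos.mpr hM), S, hSc, hSdim, U, hU, fun hS' ↦ ?_⟩
  set W : (X' ⊗ T).left.Opens := (snd X' T).left ⁻¹ᵁ U with hWdef
  set V : (X ⊗ T).left.Opens := (fst X T).left ⁻¹ᵁ ⟨Sᶜ, hS'⟩ ⊓ (snd X T).left ⁻¹ᵁ U with hVdef
  have hrange : Set.range (W.ι ≫ jO).base = Set.range V.ι.base := by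
    rw [Scheme.Opens.range_ι]
    ext x
    constructor
    · rintro ⟨w', rfl⟩
      refine ⟨?_, ?_⟩
      · change (fst X T).left.base (jO.base (W.ι.base w')) ∈ Sᶜ
        rw [← Scheme.Hom.comp_apply jO, hjOfst]
        have hmem : O.ι.base ((fst X' T).left.base (W.ι.base w')) ∈ (O : Set X.left) := by
          rw [← Scheme.Opens.range_ι]; exact ⟨_, rfl⟩
        exact hmem
      · change (snd X T).left.base (jO.base (W.ι.base w')) ∈ U
        rw [← Scheme.Hom.comp_apply jO, hjOsnd]
        exact w'.2
    · rintro ⟨hx₁, hx₂⟩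
      have hx₁' : (fst X T).left.base x ∈ Set.range O.ι.base := by
        rw [Scheme.Opens.range_ι]; exact hx₁
      have hxr : x ∈ Set.range jO.base := by
        rw [range_fst_of_isPullback HjO]; exact hx₁'
      obtain ⟨w', rfl⟩ := hxr
      have hw'U : w' ∈ W := by
        change (snd X' T).left.base w' ∈ U
        rw [← hjOsnd, Scheme.Hom.comp_apply]
        exact hx₂
      exact ⟨⟨w', hw'U⟩, rfl⟩
  let θ := IsOpenImmersion.isoOfRangeEq (W.ι ≫ jO) V.ι hrange
  have hθ : θ.inv ≫ W.ι ≫ jO = V.ι := IsOpenImmersion.isoOfRangeEq_inv_fac _ _ _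
  -- Fulton's Thm. 1.7 for the isomorphism `θ⁻¹ : V → W` over `C`
  haveI : TopologicalSpace.NoetherianSpace ↥(W : Scheme.{0}) :=
    W.ι.isOpenEmbedding.isInducing.noetherianSpace
  let Wo : SchemeOver C := Over.mk (W.ι ≫ (X' ⊗ T).hom)
  let Vo : SchemeOver C := Over.mk (V.ι ≫ (X ⊗ T).hom)
  have hθw : θ.inv ≫ Wo.hom = Vo.hom := by
    change θ.inv ≫ W.ι ≫ (X' ⊗ T).hom = V.ι ≫ (X ⊗ T).hom
    rw [← Over.w (ι' ▷ T)]
    change θ.inv ≫ W.ι ≫ jO ≫ (X ⊗ T).hom = V.ι ≫ (X ⊗ T).hom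
    rw [← Category.assoc W.ι, ← Category.assoc θ.inv, hθ]
  let θo : Vo ⟶ Wo := Over.homMk θ.inv hθw
  haveI : LocallyOfFiniteType Wo.hom := inferInstanceAs (LocallyOfFiniteType (W.ι ≫ (X' ⊗ T).hom))
  haveI : QuasiCompact Wo.hom := inferInstanceAs (QuasiCompact (W.ι ≫ (X' ⊗ T).hom))
  haveI : Flat θo.left := inferInstanceAs (Flat θ.inv)
  haveI : LocallyOfFiniteType θo.left := inferInstanceAs (LocallyOfFiniteType θ.inv)
  haveI : QuasiCompact θo.left := inferInstanceAs (QuasiCompact θ.inv)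
  have hW : flatPullback W.ι hf (flatPullback jO hf ((N * M.natAbs) • c)) ∈
      ratTrivial (W : Scheme.{0}) (k + e) := by
    have key : ((N * M.natAbs : ℕ) : ℤ) = N * M ∨ ((N * M.natAbs : ℕ) : ℤ) = -(N * M) := by
      rcases Int.natAbs_eq M with h | h
      · left
        rw [Nat.cast_mul, ← h]
      · right
        have h' : (M.natAbs : ℤ) = -M := by omega
        rw [Nat.cast_mul, h']
        ring
    rw [← natCast_zsmul, smul_smul] at hratU
    rw [← natCast_zsmul]
    rcases key with h | h
    · rw [h]; exact hratU
    · rw [h, neg_smul, map_neg, map_neg]; exact neg_mem hratU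
  have hV := flatPullback_mem_ratTrivial_of_finiteType_holds θo hf
    (isEquidimensional_zero_of_isOpenImmersion θ.inv) hW
  change flatPullback θ.inv hf (flatPullback W.ι hf (flatPullback jO hf ((N * M.natAbs) • c))) ∈
    ratTrivial (V : Scheme.{0}) (k + e + 0) at hV
  rw [Nat.add_zero] at hV
  convert hV using 1
  ext v
  rw [flatPullback_apply_of_isOpenImmersion, flatPullback_apply_of_isOpenImmersion,
    flatPullback_apply_of_isOpenImmersion, flatPullback_apply_of_isOpenImmersion]
  congr 1
  rw [← Scheme.Hom.comp_apply, ← Scheme.Hom.comp_apply, hθ]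

end PrincipleForCycle

/-! ### Splitting a cycle along a set of points -/

section SplitCycle

variable {Y : Scheme.{u}}

/-- The part of a cycle on a set of points `S` and its part off `S`, as cycles (their supports
are contained in that of `c`, hence locally finite), given by the indicator formulas
`a = 𝟙_S · c`, `b = 𝟙_{Sᶜ} · c`. [folklore] -/
theorem exists_indicator_parts (c : AlgebraicCycle Y ℤ) (S : Set Y) :
    ∃ a b : AlgebraicCycle Y ℤ, (∀ z, a z = S.indicator c z) ∧ (∀ z, b z = Sᶜ.indicator c z) := by
  classical
  have hfin : ∀ g : Y → ℤ, (∀ w, g w ≠ 0 → c w ≠ 0) → ∀ z : Y, ∃ t ∈ nhds z,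
      (t ∩ Function.support g).Finite := by
    intro g hg z
    obtain ⟨t, ht, hfin⟩ := c.supportLocallyFiniteWithinDomain' z (Set.mem_univ z)
    exact ⟨t, ht, hfin.subset (Set.inter_subset_inter_right _ fun w hw ↦ hg w hw)⟩
  have hga : ∀ w, S.indicator c w ≠ 0 → c w ≠ 0 := fun w hw h0 ↦ hw (by
    by_cases h : w ∈ S
    · rw [Set.indicator_of_mem h, h0]
    · rw [Set.indicator_of_notMem h])
  have hgb : ∀ w, Sᶜ.indicator c w ≠ 0 → c w ≠ 0 := fun w hw h0 ↦ hw (by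
    by_cases h : w ∈ Sᶜ
    · rw [Set.indicator_of_mem h, h0]
    · rw [Set.indicator_of_notMem h])
  exact ⟨{ toFun := S.indicator c
           supportWithinDomain' := Set.subset_univ _
           supportLocallyFiniteWithinDomain' := fun z _ ↦ hfin _ hga z },
    { toFun := Sᶜ.indicator c
      supportWithinDomain' := Set.subset_univ _
      supportLocallyFiniteWithinDomain' := fun z _ ↦ hfin _ hgb z },
    fun _ ↦ rfl, fun _ ↦ rfl⟩

/-- A cycle splits as the sum of its part on a set of points `S` and its part off `S`, with the
bookkeeping of supports used below (from `exists_indicator_parts`). [folklore] -/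
theorem exists_add_eq_and_support_subset' (c : AlgebraicCycle Y ℤ) (S : Set Y) :
    ∃ a b : AlgebraicCycle Y ℤ, a + b = c ∧ (∀ z, a z ≠ 0 → z ∈ S ∧ a z = c z) ∧
      (∀ z, b z ≠ 0 → z ∉ S ∧ b z = c z) ∧ (∀ z, a z ≠ 0 → c z ≠ 0) ∧ (∀ z, b z ≠ 0 → c z ≠ 0) := by
  obtain ⟨a, b, ha, hb⟩ := exists_indicator_parts c S
  have ha' : ∀ z, a z ≠ 0 → z ∈ S ∧ a z = c z := fun z hz ↦ by
    rw [ha] at hz ⊢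
    by_cases hzS : z ∈ S
    · exact ⟨hzS, Set.indicator_of_mem hzS _⟩
    · exact (hz (Set.indicator_of_notMem hzS _)).elim
  have hb' : ∀ z, b z ≠ 0 → z ∉ S ∧ b z = c z := fun z hz ↦ by
    rw [hb] at hz ⊢
    by_cases hzS : z ∈ Sᶜ
    · exact ⟨hzS, Set.indicator_of_mem hzS _⟩
    · exact (hz (Set.indicator_of_notMem hzS _)).elim
  refine ⟨a, b, ?_, ha', hb', fun z hz ↦ ?_, fun z hz ↦ ?_⟩
  · ext w
    rw [Function.locallyFinsuppWithin.coe_add, Pi.add_apply, ha, hb]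
    by_cases hw : w ∈ S
    · rw [Set.indicator_of_mem hw, Set.indicator_of_notMem (fun h : w ∈ Sᶜ ↦ h hw), add_zero]
    · rw [Set.indicator_of_notMem hw, Set.indicator_of_mem (show w ∈ Sᶜ from hw), zero_add]
  · rw [← (ha' z hz).2]; exact hz
  · rw [← (hb' z hz).2]; exact hz

end SplitCycle

/-! ### The induction step of Thm. 10.29 at one component of `T` -/

section InductionStep

open CartesianMonoidalCategory

variable {C : Type} [Field C] [IsAlgClosed C] [CharZero C]

/-- **One step of the induction of Voisin II, Thm. 10.29, at one component `T = closure {t}` of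
codimension `k` (base = second factor).** For `X` smooth projective of dimension `n` over an
uncountable algebraically closed `C` of characteristic `0` whose `k`-cycles have rank `≤ 1` up to
rational equivalence, an `n`-cycle `Z` on `X × X` and a point `t ∈ X` of dimension `n - k`:
`N • Z ∼ A + B` with `N > 0`, where `A` is supported in `W_k × closure {t}` for points of
dimension `≤ k` in the first factor ("`Z_k ⊂ W_k × W'_k`"), and every point of the support of `B`
either is a point of the support of `Z` not lying over `t`, or lies over a point strictly below
`t` ("`Z''` supported over `T'`, `codim T' ≥ k + 1`"). Proof (pp. 264–265 with the generic point
of `T` in place of a desingularisation): restrict the part of `Z` over `t` to `X × T`; by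
`exists_open_nsmul_restrict_mem_ratTrivial` a multiple is rationally trivial on `(X ∖ S) × U`,
`dim S ≤ k`, `U ⊆ T` dense open; the localisation sequence on `X × T` (Fulton Prop. 1.8) and
proper push-forward along `X × T ↪ X × X` (Fulton Thm. 1.4) give the decomposition, the
remainder being supported over `S` in the first factor and `U` in the second (the cycle `A`) or
over `T ∖ U` (in `B`). [cite: VoisinHodgeII2003, Thm. 10.29 (proof, pp. 264–265)]
[cite: Fulton1998, Proposition 1.8 and Theorem 1.4] -/
theorem inductionStep_component (hC : ℵ₀ < #C) {n : ℕ} {X : SchemeOver C}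
    (hX : IsSmoothProjective n X) {k : ℕ} (hkn : k ≤ n)
    (hH : ∀ c ∈ cyclesOfDim X.left k, ∀ c' ∈ cyclesOfDim X.left k,
      ∃ a b : ℤ, (a ≠ 0 ∨ b ≠ 0) ∧ IsRationallyEquivalent (a • c) (b • c') k)
    (hf : locallyFinsupp_flatPullbackFun.{0})
    {Z : AlgebraicCycle (X ⊗ X).left ℤ} (hZn : Z ∈ cyclesOfDim (X ⊗ X).left n)
    (t : X.left) (ht : height t = (n - k : ℕ)) :
    ∃ N : ℕ, 0 < N ∧ ∃ A B : AlgebraicCycle (X ⊗ X).left ℤ,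
      A ∈ cyclesOfDim (X ⊗ X).left n ∧ B ∈ cyclesOfDim (X ⊗ X).left n ∧
      (∀ z, A z ≠ 0 → height ((fst X X).left.base z) ≤ k ∧ (snd X X).left.base z ≤ t) ∧
      (∀ z, B z ≠ 0 → (Z z ≠ 0 ∧ (snd X X).left.base z ≠ t) ∨ (snd X X).left.base z < t) ∧
      IsRationallyEquivalent (N • Z) (A + B) n := by
  classical
  -- standing instances on `X` and `X × X`
  haveI := hX.smoothOfRelativeDimension
  haveI : IsIntegral X.left := IsSmoothProjective.isIntegral_holds hX
  haveI : IsProper X.hom := IsSmoothProjective.isProper_holds hX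
  haveI : QuasiCompact X.hom := IsSmoothProjective.quasiCompact_holds hX
  haveI : CompactSpace ↥X.left := IsSmoothProjective.compactSpace_holds hX
  haveI : IsLocallyNoetherian X.left := LocallyOfFiniteType.isLocallyNoetherian X.hom
  haveI : LocallyOfFiniteType (X ⊗ X).hom :=
    inferInstanceAs (LocallyOfFiniteType (pullback.fst X.hom X.hom ≫ X.hom))
  haveI : QuasiCompact (X ⊗ X).hom := inferInstanceAs (QuasiCompact (pullback.fst X.hom X.hom ≫ X.hom))
  haveI : IsLocallyNoetherian (X ⊗ X).left := LocallyOfFiniteType.isLocallyNoetherian (X ⊗ X).hom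
  -- the component `T = closure {t}` as a `C`-variety and `ι : X × T ↪ X × X`
  let T := ClosedSubvariety.ofPoint X.left t
  let Tj : SchemeOver C := Over.mk (T.ι ≫ X.hom)
  let ιT : Tj ⟶ X := Over.homMk T.ι rfl
  haveI : IsIntegral Tj.left := inferInstanceAs (IsIntegral T.carrier)
  haveI : LocallyOfFiniteType Tj.hom := inferInstanceAs (LocallyOfFiniteType (T.ι ≫ X.hom))
  haveI : QuasiCompact Tj.hom := inferInstanceAs (QuasiCompact (T.ι ≫ X.hom))
  haveI : LocallyOfFiniteType (X ⊗ Tj).hom :=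
    inferInstanceAs (LocallyOfFiniteType (pullback.fst X.hom Tj.hom ≫ X.hom))
  haveI : QuasiCompact (X ⊗ Tj).hom := inferInstanceAs (QuasiCompact (pullback.fst X.hom Tj.hom ≫ X.hom))
  haveI : IsLocallyNoetherian (X ⊗ Tj).left := LocallyOfFiniteType.isLocallyNoetherian (X ⊗ Tj).hom
  have hTt : T.ι.base (genericPoint T.carrier) = t := ClosedSubvariety.genericPoint_ofPoint (X := X.left) t
  have he : height (genericPoint Tj.left) = (n - k : ℕ) := by
    change height (genericPoint T.carrier) = _
    rw [← height_base_eq_of_isClosedImmersion' T.ι, hTt, ht]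
  let ι : (X ⊗ Tj).left ⟶ (X ⊗ X).left := (X ◁ ιT).left
  have hιfst : ι ≫ (fst X X).left = (fst X Tj).left := Over.whiskerLeft_left_fst ιT
  have hιsnd : ι ≫ (snd X X).left = (snd X Tj).left ≫ T.ι := Over.whiskerLeft_left_snd ιT
  have Hι : IsPullback ι (snd X Tj).left (snd X X).left T.ι := isPullback_whiskerLeft X ιT
  haveI : IsClosedImmersion ι := MorphismProperty.of_isPullback Hι.flip (inferInstance : IsClosedImmersion T.ι)
  have hTrange : Set.range T.ι.base = closure {t} := ClosedSubvariety.range_ofPoint_ι (X := X.left) (x := t)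
  have hrange : Set.range ι.base = (snd X X).left.base ⁻¹' closure {t} := by
    rw [Literature.AlgebraicGeometry.Limits.range_fst_of_isPullback Hι, ← hTrange]
    rfl
  -- the part of `Z` over `t`, restricted to `X × T`
  obtain ⟨Zt, Zr, hadd, hZt, hZr, hZtc, hZrc⟩ :=
    exists_add_eq_and_support_subset' Z {z | (snd X X).left.base z = t}
  have hZtn : Zt ∈ cyclesOfDim (X ⊗ X).left n := fun z hz ↦ hZn z (hZtc z hz)
  have hZrn : Zr ∈ cyclesOfDim (X ⊗ X).left n := fun z hz ↦ hZn z (hZrc z hz)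
  set c := algebraicCycleComap ι ι.isClosedEmbedding.injective Zt with hcdef
  have hmapc : AlgebraicCycle.map ι height height c = Zt := by
    refine algebraicCycleMap_comap ι Zt fun z hz ↦ ?_
    by_contra hne
    apply hz
    rw [hrange, Set.mem_preimage, (hZt z hne).1]
    exact subset_closure rfl
  have hcn : c ∈ cyclesOfDim (X ⊗ Tj).left (k + (n - k)) := by
    rw [Nat.add_sub_cancel' hkn]
    exact algebraicCycleComap_mem_cyclesOfDim ι hZtn
  -- the principle over `T`
  obtain ⟨N, hN, S, hSc, hSdim, U, hU, hV⟩ :=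
    exists_open_nsmul_restrict_mem_ratTrivial hC X hX.isProjectiveOver (T := Tj) he hH hf hcn
  have hV' := hV hSc.isOpen_compl
  rw [Nat.add_sub_cancel' hkn] at hV'
  set V : (X ⊗ Tj).left.Opens := (fst X Tj).left ⁻¹ᵁ ⟨Sᶜ, hSc.isOpen_compl⟩ ⊓ (snd X Tj).left ⁻¹ᵁ U
    with hVdef
  -- localisation on `X × T` and push-forward along `ι`
  have hNc : N • c ∈ cyclesOfDim (X ⊗ Tj).left n :=
    AddSubgroup.nsmul_mem _ (by rw [← Nat.add_sub_cancel' hkn]; exact hcn) N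
  obtain ⟨c', hc'n, hsupp, hre⟩ := Fulton1998_localizationSequence_holds (X ⊗ Tj) V hf n (N • c) hNc hV'
  haveI : IsProper (X ◁ ιT).left := inferInstanceAs (IsProper ι)
  have hpush : AlgebraicCycle.map ι height height (N • c - c') ∈ ratTrivial (X ⊗ X).left n :=
    map_mem_ratTrivial_of_facts map_div_eq_zero_of_dim_eq_add_one_holds map_div_eq_div_norm_holds n
      (X ◁ ιT) hre
  set P := AlgebraicCycle.map ι height height c' with hPdef
  have hPn : P ∈ cyclesOfDim (X ⊗ X).left n := map_mem_cyclesOfDim ι hc'n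
  have hkey : N • Zt - P ∈ ratTrivial (X ⊗ X).left n := by
    have h : AlgebraicCycle.map ι height height (N • c - c') = N • Zt - P := by
      rw [← hmapc, hPdef]
      change (AddMonoidHom.mk' (AlgebraicCycle.map ι height height) (algebraicCycleMap_add ι _ _)) (N • c - c') = _
      rw [map_sub, map_nsmul]
      rfl
    rwa [h] at hpush
  -- the support of `P = ι_* c'`
  have hPsupp : ∀ w, P w ≠ 0 → ∃ z, ι.base z = w ∧ c' z ≠ 0 := by
    intro w hw
    by_cases hwr : w ∈ Set.range ι.base
    · obtain ⟨z, rfl⟩ := hwr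
      refine ⟨z, rfl, ?_⟩
      rwa [hPdef, algebraicCycleMap_apply_base_of_isClosedImmersion] at hw
    · exact (hw (algebraicCycleMap_apply_of_notMem_range ι c' hwr)).elim
  have hξU : genericPoint T.carrier ∈ U :=
    ((genericPoint_spec T.carrier).mem_open_set_iff U.isOpen).mpr (by
      obtain ⟨x, hx⟩ := hU
      exact ⟨x, Set.mem_univ _, hx⟩)
  -- split `P` into the part over `U` (the cycle `A`) and the rest
  obtain ⟨A, B₀, hAB, hA, hB₀, hAc, hB₀c⟩ := exists_add_eq_and_support_subset' P
    {w | (snd X X).left.base w ∈ T.ι.base '' (U : Set Tj.left)}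
  have hAn : A ∈ cyclesOfDim (X ⊗ X).left n := fun z hz ↦ hPn z (hAc z hz)
  have hB₀n : B₀ ∈ cyclesOfDim (X ⊗ X).left n := fun z hz ↦ hPn z (hB₀c z hz)
  refine ⟨N, hN, A, B₀ + N • Zr, hAn, add_mem hB₀n (AddSubgroup.nsmul_mem _ hZrn N), ?_, ?_, ?_⟩
  · -- `A ⊂ W_k × closure {t}`
    intro w hw
    obtain ⟨hwU, hwP⟩ := hA w hw
    obtain ⟨z, rfl, hz⟩ := hPsupp w (by rw [← hwP]; exact hw)
    have hzV : z ∉ V := hsupp z hz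
    have hsndz : (snd X X).left.base (ι.base z) = T.ι.base ((snd X Tj).left.base z) := by
      rw [← Scheme.Hom.comp_apply ι, hιsnd]; rfl
    have hfstz : (fst X X).left.base (ι.base z) = (fst X Tj).left.base z := by
      rw [← Scheme.Hom.comp_apply ι, hιfst]
    obtain ⟨u, huU, hu⟩ := hwU
    rw [hsndz] at hu
    have huz : u = (snd X Tj).left.base z := T.ι_base_injective hu
    constructor
    · rw [hfstz]
      apply hSdim
      by_contra hS
      exact hzV ⟨hS, show (snd X Tj).left.base z ∈ U from huz ▸ huU⟩
    · rw [hsndz]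
      refine Scheme.le_iff_specializes.mpr (specializes_iff_mem_closure.mpr ?_)
      rw [← hTrange]
      exact ⟨_, rfl⟩
  · -- the support of `B = B₀ + N • Zr`
    intro w hw
    by_cases hB₀w : B₀ w = 0
    swap
    · right
      obtain ⟨hwU, hwP⟩ := hB₀ w hB₀w
      obtain ⟨z, rfl, hz⟩ := hPsupp w (by rw [← hwP]; exact hB₀w)
      have hsndz : (snd X X).left.base (ι.base z) = T.ι.base ((snd X Tj).left.base z) := by
        rw [← Scheme.Hom.comp_apply ι, hιsnd]; rfl
      have hle : (snd X X).left.base (ι.base z) ≤ t := by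
        rw [hsndz]
        refine Scheme.le_iff_specializes.mpr (specializes_iff_mem_closure.mpr ?_)
        rw [← hTrange]
        exact ⟨_, rfl⟩
      refine lt_of_le_not_ge hle fun hge ↦ hwU ?_
      have heq : (snd X X).left.base (ι.base z) = t :=
        ((Scheme.le_iff_specializes.mp hge).antisymm (Scheme.le_iff_specializes.mp hle)).eq
      rw [hsndz, ← hTt] at heq
      have hξ : (snd X Tj).left.base z = genericPoint T.carrier := T.ι_base_injective heq
      change (snd X X).left.base (ι.base z) ∈ T.ι.base '' (U : Set Tj.left)
      rw [hsndz, hξ]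
      exact ⟨_, hξU, rfl⟩
    · left
      have hZrw : Zr w ≠ 0 := by
        intro h0
        apply hw
        rw [Function.locallyFinsuppWithin.coe_add, Pi.add_apply, hB₀w, zero_add,
          Function.locallyFinsuppWithin.coe_nsmul, Pi.smul_apply, h0, smul_zero]
      obtain ⟨hwt, hwZ⟩ := hZr w hZrw
      exact ⟨by rw [← hwZ]; exact hZrw, hwt⟩
  · -- `N • Z ∼ A + B`
    change N • Z - (A + (B₀ + N • Zr)) ∈ ratTrivial (X ⊗ X).left n
    have h : N • Z - (A + (B₀ + N • Zr)) = N • Zt - P := by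
      rw [← hadd, ← hAB, smul_add]
      abel
    rw [h]
    exact hkey

end InductionStep

/-! ### The induction step of Thm. 10.29 at all components of codimension `k` -/

section InductionLevel

open CartesianMonoidalCategory

variable {C : Type} [Field C] [IsAlgClosed C] [CharZero C]

omit [IsAlgClosed C] [CharZero C] in
/-- `height + coheight = n` on a smooth projective `n`-fold (Hartshorne II Ex. 3.20 (d)), from the
tree's `height_add_coheight_eq_of_smoothOfRelativeDimension`. [cite: Hartshorne1977, II Ex. 3.20 (d)] -/
theorem height_add_coheight_of_isSmoothProjective {n : ℕ} {X : SchemeOver C}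
    (hX : IsSmoothProjective n X) (z : X.left) : height z + coheight z = n := by
  haveI := hX.smoothOfRelativeDimension
  haveI := hX.geometricallyIrreducible
  haveI : IrreducibleSpace ↥X.left := GeometricallyIrreducible.irreducibleSpace_of_subsingleton X.hom
  exact height_add_coheight_eq_of_smoothOfRelativeDimension X.hom n z

/-- **The induction step `k ↦ k + 1` of Voisin II, Thm. 10.29 (base = second factor).** For `X`
smooth projective of dimension `n` over an uncountable algebraically closed `C` of characteristic
`0` whose `k`-cycles have rank `≤ 1` (`k ≤ n`), and an `n`-cycle `Z` on `X × X` all of whose points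
lie over points of codimension `≥ k` in the second factor: `N • Z ∼ A + B` with `N > 0`, `A`
supported over points of dimension `≤ k` in the first factor and `≤ n - k` in the second
("`Z_k ⊂ W'_k × W_k`" transposed), and `B` supported over points of codimension `≥ k + 1` in the
second factor ("`Z'` supported in `T × X`, `codim T ≥ k₀ + 1`"). Induction on the number of
points of codimension exactly `k` under the support (`inductionStep_component` at each).
[cite: VoisinHodgeII2003, Thm. 10.29 (proof, pp. 264–265)] -/
theorem inductionStep_level (hC : ℵ₀ < #C) {n : ℕ} {X : SchemeOver C}
    (hX : IsSmoothProjective n X) {k : ℕ} (hkn : k ≤ n)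
    (hH : ∀ c ∈ cyclesOfDim X.left k, ∀ c' ∈ cyclesOfDim X.left k,
      ∃ a b : ℤ, (a ≠ 0 ∨ b ≠ 0) ∧ IsRationallyEquivalent (a • c) (b • c') k)
    (hf : locallyFinsupp_flatPullbackFun.{0})
    {Z : AlgebraicCycle (X ⊗ X).left ℤ} (hZn : Z ∈ cyclesOfDim (X ⊗ X).left n)
    (hZk : ∀ z, Z z ≠ 0 → (k : ℕ∞) ≤ coheight ((snd X X).left.base z)) :
    ∃ N : ℕ, 0 < N ∧ ∃ A B : AlgebraicCycle (X ⊗ X).left ℤ,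
      A ∈ cyclesOfDim (X ⊗ X).left n ∧ B ∈ cyclesOfDim (X ⊗ X).left n ∧
      (∀ z, A z ≠ 0 → height ((fst X X).left.base z) ≤ k ∧
        height ((snd X X).left.base z) ≤ (n - k : ℕ)) ∧
      (∀ z, B z ≠ 0 → ((k + 1 : ℕ) : ℕ∞) ≤ coheight ((snd X X).left.base z)) ∧
      IsRationallyEquivalent (N • Z) (A + B) n := by
  classical
  haveI : QuasiCompact X.hom := IsSmoothProjective.quasiCompact_holds hX
  haveI : CompactSpace ↥X.left := IsSmoothProjective.compactSpace_holds hX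
  haveI : QuasiCompact (snd X X).left := inferInstanceAs (QuasiCompact (pullback.snd X.hom X.hom))
  haveI : CompactSpace ↥(X ⊗ X).left := QuasiCompact.compactSpace_of_compactSpace (snd X X).left
  -- the bad points: images in the second factor, of codimension exactly `k`, of the support
  have hfinsupp : ∀ Z : AlgebraicCycle (X ⊗ X).left ℤ, (Function.support Z).Finite := fun Z ↦ by
    have h := Z.locallyFiniteSupport.finite_inter_support_of_isCompact isCompact_univ
    rwa [Set.univ_inter] at h
  let bad : AlgebraicCycle (X ⊗ X).left ℤ → Finset X.left := fun Z ↦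
    ((hfinsupp Z).toFinset.image fun z ↦ (snd X X).left.base z).filter fun w ↦ coheight w = k
  have hbad : ∀ (Z : AlgebraicCycle (X ⊗ X).left ℤ) (w : X.left),
      w ∈ bad Z ↔ (∃ z, Z z ≠ 0 ∧ (snd X X).left.base z = w) ∧ coheight w = k := by
    intro Z w
    simp only [bad, Finset.mem_filter, Finset.mem_image, Set.Finite.mem_toFinset, Function.mem_support]
  -- induction on the number of bad points
  suffices H : ∀ (m : ℕ) (Z : AlgebraicCycle (X ⊗ X).left ℤ), Z ∈ cyclesOfDim (X ⊗ X).left n →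
      (∀ z, Z z ≠ 0 → (k : ℕ∞) ≤ coheight ((snd X X).left.base z)) → (bad Z).card ≤ m →
      ∃ N : ℕ, 0 < N ∧ ∃ A B : AlgebraicCycle (X ⊗ X).left ℤ,
        A ∈ cyclesOfDim (X ⊗ X).left n ∧ B ∈ cyclesOfDim (X ⊗ X).left n ∧
        (∀ z, A z ≠ 0 → height ((fst X X).left.base z) ≤ k ∧
          height ((snd X X).left.base z) ≤ (n - k : ℕ)) ∧
        (∀ z, B z ≠ 0 → ((k + 1 : ℕ) : ℕ∞) ≤ coheight ((snd X X).left.base z)) ∧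
        IsRationallyEquivalent (N • Z) (A + B) n from H _ Z hZn hZk le_rfl
  intro m
  induction m with
  | zero =>
    intro Z hZn hZk hcard
    refine ⟨1, one_pos, 0, Z, zero_mem _, hZn, fun z hz ↦ (hz rfl).elim, fun z hz ↦ ?_, ?_⟩
    · have hle := hZk z hz
      have hne : coheight ((snd X X).left.base z) ≠ k := fun h ↦ by
        have hmem : (snd X X).left.base z ∈ bad Z := (hbad Z _).mpr ⟨⟨z, hz, rfl⟩, h⟩
        rw [Nat.le_zero, Finset.card_eq_zero] at hcard
        rw [hcard] at hmem
        exact Finset.notMem_empty _ hmem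
      have hlt : (k : ℕ∞) < coheight ((snd X X).left.base z) := lt_of_le_of_ne hle (Ne.symm hne)
      exact Order.add_one_le_of_lt hlt
    · rw [one_smul, zero_add]
      exact IsRationallyEquivalent.refl _
  | succ m ih =>
    intro Z hZn hZk hcard
    by_cases hempty : bad Z = ∅
    · exact ih Z hZn hZk (by rw [hempty, Finset.card_empty]; exact Nat.zero_le _)
    obtain ⟨t, htbad⟩ := Finset.nonempty_iff_ne_empty.mpr hempty
    obtain ⟨-, htk⟩ := (hbad Z t).mp htbad
    have hht : height t = (n - k : ℕ) := by
      have h := height_add_coheight_of_isSmoothProjective hX t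
      rw [htk] at h
      have hfin : height t ≠ ⊤ := by
        intro htop; rw [htop, top_add] at h; exact ENat.top_ne_coe n h
      obtain ⟨a, ha⟩ := ENat.ne_top_iff_exists.mp hfin
      rw [← ha] at h ⊢
      have h' : a + k = n := by exact_mod_cast h
      congr 1
      omega
    -- one component
    obtain ⟨N₁, hN₁, A₁, B₁, hA₁n, hB₁n, hA₁, hB₁, hre₁⟩ :=
      inductionStep_component hC hX hkn hH hf hZn t hht
    -- the remainder has fewer bad points
    have hB₁k : ∀ z, B₁ z ≠ 0 → (k : ℕ∞) ≤ coheight ((snd X X).left.base z) := by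
      intro z hz
      rcases hB₁ z hz with ⟨hZz, -⟩ | hlt
      · exact hZk z hZz
      · have h1 := Order.coheight_add_one_le hlt
        rw [htk] at h1
        exact le_trans (le_self_add) h1
    have hsub : bad B₁ ⊆ (bad Z).erase t := by
      intro w hw
      obtain ⟨⟨z, hz, rfl⟩, hwk⟩ := (hbad B₁ w).mp hw
      rw [Finset.mem_erase]
      rcases hB₁ z hz with ⟨hZz, hne⟩ | hlt
      · exact ⟨hne, (hbad Z _).mpr ⟨⟨z, hZz, rfl⟩, hwk⟩⟩
      · exfalso
        have h1 := Order.coheight_add_one_le hlt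
        rw [htk, hwk] at h1
        have h2 : ((k + 1 : ℕ) : ℕ∞) ≤ k := by exact_mod_cast h1
        exact absurd (by exact_mod_cast h2 : k + 1 ≤ k) (by omega)
    have hcard₁ : (bad B₁).card ≤ m := by
      have h1 := Finset.card_le_card hsub
      rw [Finset.card_erase_of_mem htbad] at h1
      omega
    obtain ⟨N₂, hN₂, A₂, B₂, hA₂n, hB₂n, hA₂, hB₂, hre₂⟩ := ih B₁ hB₁n hB₁k hcard₁
    refine ⟨N₂ * N₁, Nat.mul_pos hN₂ hN₁, N₂ • A₁ + A₂, B₂,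
      add_mem (AddSubgroup.nsmul_mem _ hA₁n N₂) hA₂n, hB₂n, fun z hz ↦ ?_, hB₂, ?_⟩
    · -- supports of `N₂ • A₁ + A₂`
      by_cases h1 : A₁ z = 0
      · have hA₂z : A₂ z ≠ 0 := by
          intro h0; apply hz
          rw [Function.locallyFinsuppWithin.coe_add, Pi.add_apply, h0, add_zero,
            Function.locallyFinsuppWithin.coe_nsmul, Pi.smul_apply, h1, smul_zero]
        exact hA₂ z hA₂z
      · obtain ⟨hfst, hsnd⟩ := hA₁ z h1
        refine ⟨hfst, ?_⟩
        calc height ((snd X X).left.base z) ≤ height t := Order.height_mono hsnd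
          _ = (n - k : ℕ) := hht
    · -- `N₂ N₁ • Z ∼ N₂ • A₁ + A₂ + B₂`
      have h1 : IsRationallyEquivalent ((N₂ * N₁) • Z) (N₂ • (A₁ + B₁)) n := by
        rw [mul_smul]
        change N₂ • (N₁ • Z) - N₂ • (A₁ + B₁) ∈ ratTrivial (X ⊗ X).left n
        rw [← smul_sub]
        exact AddSubgroup.nsmul_mem _ hre₁ N₂
      have h2 : IsRationallyEquivalent (N₂ • (A₁ + B₁)) (N₂ • A₁ + A₂ + B₂) n := by
        change N₂ • (A₁ + B₁) - (N₂ • A₁ + A₂ + B₂) ∈ ratTrivial (X ⊗ X).left n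
        have h3 : N₂ • (A₁ + B₁) - (N₂ • A₁ + A₂ + B₂) = N₂ • B₁ - (A₂ + B₂) := by
          rw [smul_add]; abel
        rw [h3]
        exact hre₂
      exact h1.trans h2

end InductionLevel

/-! ### The induction on `k`, the transposition, and the discharge -/

section Final

open CartesianMonoidalCategory

variable {C : Type} [Field C] [IsAlgClosed C] [CharZero C]

omit [IsAlgClosed C] [CharZero C] in
/-- The generic point of the diagonal of a smooth projective `n`-fold has dimension `n` (it is the
image of the generic point of `X`, of codimension `0`, under the closed immersion `Δ`).
[cite: VoisinHodgeII2003, Cor. 10.21] [cite: Hartshorne1977, II Ex. 3.20] -/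
theorem height_eq_of_isGenericPoint_diagonal' {n : ℕ} {X : SchemeOver C} (hX : IsSmoothProjective n X)
    {δ : ↥(X ⊗ X).left}
    (hδ : IsGenericPoint δ (Set.range (CartesianMonoidalCategory.lift (𝟙 X) (𝟙 X)).left.base)) :
    height δ = n := by
  haveI := hX.geometricallyIrreducible
  haveI : IrreducibleSpace ↥X.left := GeometricallyIrreducible.irreducibleSpace_of_subsingleton X.hom
  haveI : IsProper X.hom := IsSmoothProjective.isProper_holds hX
  set Δ := (CartesianMonoidalCategory.lift (𝟙 X) (𝟙 X)).left with hΔ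
  haveI : IsClosedImmersion Δ := inferInstanceAs (IsClosedImmersion (pullback.diagonal X.hom))
  have hη : IsGenericPoint (Δ.base (genericPoint X.left)) (Set.range Δ.base) := by
    have h := (genericPoint_spec X.left).image Δ.base.hom.continuous
    rwa [Set.image_univ, Δ.isClosedEmbedding.isClosed_range.closure_eq] at h
  rw [hδ.eq hη, height_base_eq_of_isClosedImmersion' Δ]
  have h := height_add_coheight_of_isSmoothProjective hX (genericPoint X.left)
  have hmax : coheight (genericPoint X.left) = 0 := by
    rw [Order.coheight_eq_zero]
    intro b _
    exact Scheme.le_iff_specializes.mpr (genericPoint_specializes b)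
  rwa [hmax, add_zero] at h

/-- **Voisin II, Thm. 10.29 by induction on `k` (base = second factor):** for every `k ≤ k₀ + 1`
there are `m > 0`, `n`-cycles `Z₀, …, Z_{k-1}` on `X × X` with `Z_i` supported over points of
dimension `≤ i` in the first and `≤ n - i` in the second factor, and an `n`-cycle `Z'` supported
over points of codimension `≥ k` in the second factor, with `m[Δ] ∼ Σ Z_i + Z'` — the statement
(10.17) of the printed proof; the step is `inductionStep_level`.
[cite: VoisinHodgeII2003, Thm. 10.29 (proof, (10.16)–(10.17))] -/
theorem decomposition_sndForm (hC : ℵ₀ < #C) {n : ℕ} {X : SchemeOver C} (hX : IsSmoothProjective n X)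
    {k₀ : ℕ} (hrk : ChowRankLEOneUpTo X k₀) (hf : locallyFinsupp_flatPullbackFun.{0})
    (δ : ↥(X ⊗ X).left)
    (hδ : IsGenericPoint δ (Set.range (CartesianMonoidalCategory.lift (𝟙 X) (𝟙 X)).left.base)) :
    ∀ k ≤ k₀ + 1, ∃ m : ℕ, 0 < m ∧ ∃ Z' ∈ cyclesOfDim (X ⊗ X).left n,
      (∀ z, Z' z ≠ 0 → (k : ℕ∞) ≤ coheight ((snd X X).left.base z)) ∧
      ∃ Zs : Fin k → AlgebraicCycle (X ⊗ X).left ℤ, (∀ i, Zs i ∈ cyclesOfDim (X ⊗ X).left n) ∧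
        (∀ i z, Zs i z ≠ 0 → height ((fst X X).left.base z) ≤ ((i : ℕ) : ℕ∞) ∧
          height ((snd X X).left.base z) ≤ ((n - i : ℕ) : ℕ∞)) ∧
        IsRationallyEquivalent (m • primeCycle δ) ((∑ i, Zs i) + Z') n := by
  intro k
  induction k with
  | zero =>
    intro _
    refine ⟨1, one_pos, primeCycle δ, primeCycle_mem_cyclesOfDim (height_eq_of_isGenericPoint_diagonal' hX hδ),
      fun z _ ↦ by simp, Fin.elim0, fun i ↦ i.elim0, fun i ↦ i.elim0, ?_⟩
    rw [Finset.univ_eq_empty, Finset.sum_empty, zero_add, one_smul]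
    exact IsRationallyEquivalent.refl _
  | succ k ih =>
    intro hk
    obtain ⟨m, hm, Z', hZ'n, hZ'k, Zs, hZsn, hZs, hre⟩ := ih (Nat.le_of_succ_le hk)
    -- the step at level `k` (trivial if `k > n`)
    have hstep : ∃ N : ℕ, 0 < N ∧ ∃ A B : AlgebraicCycle (X ⊗ X).left ℤ,
        A ∈ cyclesOfDim (X ⊗ X).left n ∧ B ∈ cyclesOfDim (X ⊗ X).left n ∧
        (∀ z, A z ≠ 0 → height ((fst X X).left.base z) ≤ k ∧
          height ((snd X X).left.base z) ≤ (n - k : ℕ)) ∧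
        (∀ z, B z ≠ 0 → ((k + 1 : ℕ) : ℕ∞) ≤ coheight ((snd X X).left.base z)) ∧
        IsRationallyEquivalent (N • Z') (A + B) n := by
      by_cases hkn : k ≤ n
      · exact inductionStep_level hC hX hkn (hrk k (Nat.le_of_lt_succ hk)) hf hZ'n hZ'k
      · refine ⟨1, one_pos, 0, Z', zero_mem _, hZ'n, fun z hz ↦ (hz rfl).elim, fun z hz ↦ ?_, ?_⟩
        · exfalso
          have h1 := hZ'k z hz
          have h2 := height_add_coheight_of_isSmoothProjective hX ((snd X X).left.base z)
          have h3 : coheight ((snd X X).left.base z) ≤ n := by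
            rw [← h2]; exact le_add_self
          have h4 : (k : ℕ∞) ≤ n := h1.trans h3
          exact hkn (by exact_mod_cast h4)
        · rw [one_smul, zero_add]
          exact IsRationallyEquivalent.refl _
    obtain ⟨N, hN, A, B, hAn, hBn, hA, hB, hreAB⟩ := hstep
    refine ⟨N * m, Nat.mul_pos hN hm, B, hBn, hB, Fin.snoc (fun i ↦ N • Zs i) A, ?_, ?_, ?_⟩
    · intro i
      refine Fin.lastCases ?_ (fun j ↦ ?_) i
      · rw [Fin.snoc_last]; exact hAn
      · rw [Fin.snoc_castSucc]; exact AddSubgroup.nsmul_mem _ (hZsn j) N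
    · intro i
      refine Fin.lastCases ?_ (fun j ↦ ?_) i
      · intro z hz
        rw [Fin.snoc_last] at hz
        simpa only [Fin.val_last] using hA z hz
      · intro z hz
        rw [Fin.snoc_castSucc] at hz
        have hz' : Zs j z ≠ 0 := by
          intro h0; apply hz
          rw [Function.locallyFinsuppWithin.coe_nsmul, Pi.smul_apply, h0, smul_zero]
        simpa only [Fin.val_castSucc] using hZs j z hz'
    · rw [Fin.sum_univ_castSucc]
      simp only [Fin.snoc_castSucc, Fin.snoc_last]
      have h1 : IsRationallyEquivalent ((N * m) • primeCycle δ) (N • ((∑ i, Zs i) + Z')) n := by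
        rw [mul_smul]
        change N • (m • primeCycle δ) - N • ((∑ i, Zs i) + Z') ∈ ratTrivial (X ⊗ X).left n
        rw [← smul_sub]
        exact AddSubgroup.nsmul_mem _ hre N
      refine h1.trans ?_
      change N • ((∑ i, Zs i) + Z') - ((∑ i : Fin k, N • Zs i) + A + B) ∈ ratTrivial (X ⊗ X).left n
      have h2 : N • ((∑ i, Zs i) + Z') - ((∑ i : Fin k, N • Zs i) + A + B) = N • Z' - (A + B) := by
        rw [smul_add, Finset.smul_sum]; abel
      rw [h2]
      exact hreAB

end Final

/-! ### Transposition and the discharge of the named fact -/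

section Discharge

open CartesianMonoidalCategory

variable {C : Type} [Field C] [IsAlgClosed C] [CharZero C]

/-- **Voisin II, Thm. 10.29 in the shape of the named fact, over any uncountable algebraically
closed field of characteristic `0`.** From `decomposition_sndForm` at `k = k₀ + 1` by exchanging
the two factors of `X × X` (the involution `(x, y) ↦ (y, x)` fixes the diagonal and transports
rational equivalence, Fulton Thm. 1.4) and taking for `T`, `W_i`, `W'_i` the closures of the
(finitely many) projections of the supports. [cite: VoisinHodgeII2003, Thm. 10.29] -/
theorem generalisedDecompositionOfTheDiagonal_of_uncountable (hC : ℵ₀ < #C) {n : ℕ} {X : SchemeOver C}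
    (hX : IsSmoothProjective n X) {k₀ : ℕ} (hrk : ChowRankLEOneUpTo X k₀)
    (δ : ↥(X ⊗ X).left)
    (hδ : IsGenericPoint δ (Set.range (CartesianMonoidalCategory.lift (𝟙 X) (𝟙 X)).left.base)) :
    ∃ m : ℕ, 0 < m ∧
      ∃ T : Set X.left, IsClosed T ∧ (∀ t ∈ T, (k₀ + 1 : ℕ∞) ≤ Order.coheight t) ∧
      ∃ Z' ∈ cyclesOfDim (X ⊗ X).left n,
        (∀ z, Z' z ≠ 0 → (CartesianMonoidalCategory.fst X X).left.base z ∈ T) ∧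
      ∃ (Z : Fin (k₀ + 1) → AlgebraicCycle (X ⊗ X).left ℤ) (W W' : Fin (k₀ + 1) → Set X.left),
        (∀ i, Z i ∈ cyclesOfDim (X ⊗ X).left n) ∧
        (∀ i, IsClosed (W i) ∧ IsClosed (W' i)) ∧
        (∀ i, ∀ w ∈ W i, Order.height w ≤ (i : ℕ)) ∧
        (∀ i, ∀ w ∈ W' i, Order.height w ≤ (n - i : ℕ)) ∧
        (∀ i z, Z i z ≠ 0 →
          (CartesianMonoidalCategory.fst X X).left.base z ∈ W' i ∧
            (CartesianMonoidalCategory.snd X X).left.base z ∈ W i) ∧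
        IsRationallyEquivalent (m • primeCycle δ) ((∑ i, Z i) + Z') n := by
  classical
  haveI := hX.smoothOfRelativeDimension
  haveI : IsProper X.hom := IsSmoothProjective.isProper_holds hX
  haveI : QuasiCompact X.hom := IsSmoothProjective.quasiCompact_holds hX
  haveI : CompactSpace ↥X.left := IsSmoothProjective.compactSpace_holds hX
  haveI : QuasiCompact (snd X X).left := inferInstanceAs (QuasiCompact (pullback.snd X.hom X.hom))
  haveI : CompactSpace ↥(X ⊗ X).left := QuasiCompact.compactSpace_of_compactSpace (snd X X).left
  haveI : LocallyOfFiniteType (X ⊗ X).hom :=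
    inferInstanceAs (LocallyOfFiniteType (pullback.fst X.hom X.hom ≫ X.hom))
  obtain ⟨m, hm, Z', hZ'n, hZ'k, Zs, hZsn, hZs, hre⟩ :=
    decomposition_sndForm hC hX hrk locallyFinsupp_flatPullbackFun_holds δ hδ (k₀ + 1) le_rfl
  -- the exchange involution `σ`
  let σ : X ⊗ X ⟶ X ⊗ X := CartesianMonoidalCategory.lift (snd X X) (fst X X)
  have hσσ : σ ≫ σ = 𝟙 _ := by
    refine CartesianMonoidalCategory.hom_ext _ _ ?_ ?_
    · rw [Category.assoc, CartesianMonoidalCategory.lift_fst, CartesianMonoidalCategory.lift_snd,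
        Category.id_comp]
    · rw [Category.assoc, CartesianMonoidalCategory.lift_snd, CartesianMonoidalCategory.lift_fst,
        Category.id_comp]
  have hσσl : σ.left ≫ σ.left = 𝟙 _ := by rw [← Over.comp_left, hσσ]; rfl
  let e : (X ⊗ X).left ≅ (X ⊗ X).left := ⟨σ.left, σ.left, hσσl, hσσl⟩
  haveI : IsIso e.hom := e.isIso_hom
  haveI : IsClosedImmersion e.hom := inferInstance
  haveI : QuasiCompact e.hom := inferInstance
  have hefst : e.hom ≫ (fst X X).left = (snd X X).left := by
    change (σ ≫ fst X X).left = _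
    rw [CartesianMonoidalCategory.lift_fst]
  have hesnd : e.hom ≫ (snd X X).left = (fst X X).left := by
    change (σ ≫ snd X X).left = _
    rw [CartesianMonoidalCategory.lift_snd]
  have hefst' : ∀ z, (fst X X).left.base (e.hom.base z) = (snd X X).left.base z := fun z ↦ by
    rw [← Scheme.Hom.comp_apply, hefst]
  have hesnd' : ∀ z, (snd X X).left.base (e.hom.base z) = (fst X X).left.base z := fun z ↦ by
    rw [← Scheme.Hom.comp_apply, hesnd]
  -- `σ` fixes the diagonal point
  set Δ := (CartesianMonoidalCategory.lift (𝟙 X) (𝟙 X)) with hΔ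
  have hΔσ : Δ ≫ σ = Δ := by
    refine CartesianMonoidalCategory.hom_ext _ _ ?_ ?_
    · rw [Category.assoc, CartesianMonoidalCategory.lift_fst, CartesianMonoidalCategory.lift_snd,
        CartesianMonoidalCategory.lift_fst]
    · rw [Category.assoc, CartesianMonoidalCategory.lift_snd, CartesianMonoidalCategory.lift_fst,
        CartesianMonoidalCategory.lift_snd]
  haveI : IsClosedImmersion Δ.left := inferInstanceAs (IsClosedImmersion (pullback.diagonal X.hom))
  have hrangeσ : e.hom.base '' Set.range Δ.left.base = Set.range Δ.left.base := by
    rw [← Set.range_comp]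
    have h : e.hom.base ∘ Δ.left.base = (Δ ≫ σ).left.base := by
      ext x; rfl
    rw [h, hΔσ]
  have heδ : e.hom.base δ = δ := by
    have h1 : IsGenericPoint (e.hom.base δ) (Set.range Δ.left.base) := by
      have h := hδ.image e.hom.base.hom.continuous
      rwa [hrangeσ, Δ.left.isClosedEmbedding.isClosed_range.closure_eq] at h
    exact h1.eq hδ
  -- transport of the relation along `e`
  let M : AlgebraicCycle (X ⊗ X).left ℤ →+ AlgebraicCycle (X ⊗ X).left ℤ :=
    AddMonoidHom.mk' (AlgebraicCycle.map e.hom height height) (algebraicCycleMap_add e.hom _ _)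
  have hM : ∀ c, M c = AlgebraicCycle.map e.hom height height c := fun _ ↦ rfl
  have hre' : IsRationallyEquivalent (m • primeCycle δ) ((∑ i, M (Zs i)) + M Z') n := by
    have h := algebraicCycleMap_hom_mem_ratTrivial (X ⊗ X) (X ⊗ X) e (Over.w σ) hre
    change M (m • primeCycle δ - ((∑ i, Zs i) + Z')) ∈ ratTrivial (X ⊗ X).left n at h
    rw [map_sub, map_nsmul, map_add, map_sum, hM, algebraicCycleMap_hom_primeCycle, heδ] at h
    exact h
  -- supports of transported cycles
  have hMsupp : ∀ (c : AlgebraicCycle (X ⊗ X).left ℤ) w, M c w ≠ 0 → c (e.inv.base w) ≠ 0 := by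
    intro c w hw
    rwa [hM, algebraicCycleMap_hom_apply'] at hw
  have hfstinv : ∀ w, (fst X X).left.base (e.inv.base w) = (snd X X).left.base w := fun w ↦ by
    conv_rhs => rw [← show e.hom.base (e.inv.base w) = w by
      rw [← Scheme.Hom.comp_apply, e.inv_hom_id]; rfl]
    rw [hesnd']
  have hsndinv : ∀ w, (snd X X).left.base (e.inv.base w) = (fst X X).left.base w := fun w ↦ by
    conv_rhs => rw [← show e.hom.base (e.inv.base w) = w by
      rw [← Scheme.Hom.comp_apply, e.inv_hom_id]; rfl]
    rw [hefst']
  -- finiteness of supports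
  have hfinsupp : ∀ c : AlgebraicCycle (X ⊗ X).left ℤ, (Function.support c).Finite := fun c ↦ by
    have h := c.locallyFiniteSupport.finite_inter_support_of_isCompact isCompact_univ
    rwa [Set.univ_inter] at h
  -- the closed sets
  let clfst : AlgebraicCycle (X ⊗ X).left ℤ → Set X.left := fun c ↦
    ⋃ w ∈ (hfinsupp c).toFinset, closure {(fst X X).left.base w}
  let clsnd : AlgebraicCycle (X ⊗ X).left ℤ → Set X.left := fun c ↦
    ⋃ w ∈ (hfinsupp c).toFinset, closure {(snd X X).left.base w}
  have hclfst_closed : ∀ c, IsClosed (clfst c) := fun c ↦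
    (hfinsupp c).toFinset.finite_toSet.isClosed_biUnion fun _ _ ↦ isClosed_closure
  have hclsnd_closed : ∀ c, IsClosed (clsnd c) := fun c ↦
    (hfinsupp c).toFinset.finite_toSet.isClosed_biUnion fun _ _ ↦ isClosed_closure
  have hmem_clfst : ∀ c w, c w ≠ 0 → (fst X X).left.base w ∈ clfst c := fun c w hw ↦
    Set.mem_biUnion (show w ∈ ((hfinsupp c).toFinset : Set _) by
      rw [Finset.mem_coe, Set.Finite.mem_toFinset]; exact hw) (subset_closure rfl)
  have hmem_clsnd : ∀ c w, c w ≠ 0 → (snd X X).left.base w ∈ clsnd c := fun c w hw ↦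
    Set.mem_biUnion (show w ∈ ((hfinsupp c).toFinset : Set _) by
      rw [Finset.mem_coe, Set.Finite.mem_toFinset]; exact hw) (subset_closure rfl)
  have hclfst_le : ∀ c p, p ∈ clfst c → ∃ w, c w ≠ 0 ∧ p ≤ (fst X X).left.base w := by
    intro c p hp
    obtain ⟨w, hw, hpw⟩ := Set.mem_iUnion₂.mp hp
    rw [Set.Finite.mem_toFinset] at hw
    exact ⟨w, hw, Scheme.le_iff_specializes.mpr (specializes_iff_mem_closure.mpr hpw)⟩
  have hclsnd_le : ∀ c p, p ∈ clsnd c → ∃ w, c w ≠ 0 ∧ p ≤ (snd X X).left.base w := by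
    intro c p hp
    obtain ⟨w, hw, hpw⟩ := Set.mem_iUnion₂.mp hp
    rw [Set.Finite.mem_toFinset] at hw
    exact ⟨w, hw, Scheme.le_iff_specializes.mpr (specializes_iff_mem_closure.mpr hpw)⟩
  refine ⟨m, hm, clfst (M Z'), hclfst_closed _, fun p hp ↦ ?_, M Z',
    (algebraicCycleMap_hom_mem_cyclesOfDim_iff e Z').mpr hZ'n, fun z hz ↦ hmem_clfst _ z hz,
    fun i ↦ M (Zs i), fun i ↦ clsnd (M (Zs i)), fun i ↦ clfst (M (Zs i)),
    fun i ↦ (algebraicCycleMap_hom_mem_cyclesOfDim_iff e (Zs i)).mpr (hZsn i),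
    fun i ↦ ⟨hclsnd_closed _, hclfst_closed _⟩, fun i w hw ↦ ?_, fun i w hw ↦ ?_,
    fun i z hz ↦ ⟨hmem_clfst _ z hz, hmem_clsnd _ z hz⟩, hre'⟩
  · -- codimension on `T`
    obtain ⟨w, hw, hpw⟩ := hclfst_le _ p hp
    have h1 := hZ'k _ (hMsupp _ _ hw)
    rw [hsndinv] at h1
    have h2 : ((k₀ + 1 : ℕ) : ℕ∞) ≤ coheight p := h1.trans (Order.coheight_anti hpw)
    exact_mod_cast h2
  · -- dimension on `W i`
    obtain ⟨w', hw', hle⟩ := hclsnd_le _ w hw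
    have h1 := (hZs i _ (hMsupp _ _ hw')).1
    rw [hfstinv] at h1
    exact (Order.height_mono hle).trans h1
  · -- dimension on `W' i`
    obtain ⟨w', hw', hle⟩ := hclfst_le _ w hw
    have h1 := (hZs i _ (hMsupp _ _ hw')).2
    rw [hsndinv] at h1
    exact (Order.height_mono hle).trans h1

end Discharge

/-! ### The discharge over `ℂ` -/

section Complex

/-- **Paranjape (1994), Laterveer (1998): the generalised decomposition of the diagonal — Voisin II,
Theorem 10.29 (rank-one form of the hypothesis) — PROVED**, discharging the named fact
`ParanjapeLaterveer_generalisedDecompositionOfTheDiagonal` of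
`Literature/AlgebraicGeometry/Motives/GeneralisedDecompositionOfTheDiagonal`: `ℂ` is algebraically
closed of characteristic `0` with `ℵ₀ < #ℂ = 𝔠`, so `generalisedDecompositionOfTheDiagonal_of_uncountable`
applies. The proof follows the printed induction on `k₀` (pp. 264–265) with, at each component `T`
of codimension `k` of the current `T`, the generic point of `T` and Vial's isomorphism
`X_{\overline{ℂ(T)}} ≅ X` in place of a desingularisation `T̃ → T`, the cycle class and the Baire
argument, and the tree's Hilbert-scheme-free Bloch–Srinivas principle (limit argument, spreading
out, finite flat cover and trace) in place of Thm. 10.19. [cite: VoisinHodgeII2003, Thm. 10.29]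
[cite: Paranjape1994SmallChow] [cite: Laterveer1998] [cite: Vial2013, Lemma 2.1]
[cite: Voisin2019BirationalDiagonal, Thm. 2.3] -/
theorem ParanjapeLaterveer_generalisedDecompositionOfTheDiagonal_holds :
    ParanjapeLaterveer_generalisedDecompositionOfTheDiagonal := by
  intro n X hX k₀ hrk δ hδ
  have hC : ℵ₀ < #ℂ := by
    rw [Cardinal.mk_complex]
    exact Cardinal.aleph0_lt_continuum
  exact generalisedDecompositionOfTheDiagonal_of_uncountable hC hX hrk δ hδ

end Complex

end Literature.AlgebraicGeometry.Motives

end
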